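import Literature.Combinatorics.AssociationSchemes.CutMatchingRestrictionStrategies
import HarnessLib

/-!
# Pinning a vertex core INTO the cut: the matching-side cores it induces (`M`'s edges at the pinned set),
# the partition of the perfect matchings by them, crossing of anchored cores, and the transport of CUT-SIDE
# weights (trace densities) and their Kupavskii–Zakharov homogeneity to the reduced instance

Cell pnp-psdrank (summit PneNP, rung F-N2, route `ChebyshevTracialDesign`, crux stmt-PneNP-19878 `TracialDecayExp20`).
`CutMatchingRestriction(.Strategies)` is the glue of the ONE-SIDED reduction (prover MEMO-14 §1 (51)–(57)): the
Kupavskii–Zakharov spread approximation is run on the MATCHING side (cores = partial matchings `S`, trace profile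
`y(M) = tr(Y_M)/r`), the cut side is split by its pattern `U ∩ verts S`, and the cell is read in `K_m`, `m = n − 2|S|`.
The SYMMETRIC reduction asked for in MEMO-14 §3 (2) / prover g11 HANDOFF (c) («KZ on the cut side's trace profile
`x(U) = tr(X_U)/r` too, cores = vertex sets `R ⊆ U` pinned INTO the cut; the induced matching-side cores are `M`'s edges
at `R`; transport of trace-homogeneity of the cut side to the reduced instance») needs the following bookkeeping, all
elementary double counting [folklore] in the vocabulary of Rothvoß 2017 §2 / Kupavskii–Zakharov 2022 §2:

* §1 `edgesAt R M` — the edges of `M` meeting `R`; for an ANCHORED core `S` at `R` (a perfect matching of `V ⊇ R` every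
  edge of which meets `R`) the fibre `{M : edgesAt R M = S}` is the star `{M : S ⊆ M}` (`edgesAt_eq_iff_subset`);
* §2 crossing an anchored core: for `R ⊆ U`, `crossCount U S = |V ∖ U|` (`crossCount_eq_card_sdiff`) — an anchored core is
  NOT crossed iff its whole support lies in the cut, and then `cc(U, M) = cc(U ∖ V, M ∖ S)` is the crossing count of the
  reduced pair (`crossCount_split_anchored`); otherwise some edge of `S ⊆ M` crosses `U` (a crossing pin);
* §3 in `K_n`: the anchored cores `𝒮(R) = {edgesAt R M : M ∈ PM_n}` (`|S| ≤ |R| ≤ 2|S|`, `R ⊆ verts S`), the PARTITION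
  `Σ_{M ∈ Y} g(M) = Σ_{S ∈ 𝒮(R)} Σ_{M ∈ Y, S ⊆ M} g(M)` of any matching family (set, weighted, and `PMatch n` currency),
  disjointness of the stars, `Σ_{S ∈ 𝒮(R)} |PM(univ ∖ verts S)| = |PM_n|` (the sub-cells' shares sum to `1`: no entropy
  is paid for the split), joint cores `S₀ ∪ edgesAt R M`, and the dichotomy `crossCount_eq_reduced_or_exists_crossing`;
* §4 CUT-SIDE WEIGHTS: the reduced weight `Ũ ↦ x(emb(Ũ) ∪ π)` on the pulled-back pattern class `cellCuts X V π h` has the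
  mass of the pattern class (`wmass_cellCuts`); stars and refined patterns commute with the pull-back
  (`supersets_cellCuts`, `cutsWith_cellCuts`); **Kupavskii–Zakharov homogeneity of the cut weight relative to the pattern
  class `{|U| = t, U ∩ V = π}` transports EXACTLY to `(all (t − |π|)-cuts of K_m, τ)`-homogeneity of the reduced weight**
  (`isRelHomogeneousW_cellCuts`; star form `V = π = W`, the non-crossing sub-cell: `isRelHomogeneousW_cellCuts_star`);
  kernel currency (`OddSet`, `liftOdd`, zero-extended weights: `dite_weight_liftOdd`, `isRelHomogeneousW_oddCellCuts`).
  These are the cut-side companions of `wmass_cellMatchings`, `supersets_cellMatchings`, `isRelHomogeneousW_cellMatchings`,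
  `dite_weight_lift` of `CutMatchingRestrictionStrategies`;
* §5 WHAT SURVIVES A REFINEMENT, QUANTITATIVELY. Homogeneity is one-sided: a `(𝒜, τ)`-homogeneous weight may under-weight
  a sub-star, and inside an under-weighted sub-star nothing prevents concentration. Splitting a homogeneous piece by the
  other side's pins (a matching piece `Y` by `𝒮(R)`; a cut piece by the non-crossing sub-star of `W = verts S`) keeps
  homogeneity up to the RELATIVE DENSITY of the sub-class: `IsRelHomogeneousW.supersets_of_dense` — a sub-star carrying
  `≥ K⁻¹ τ^{|S|}` of its ambient share is `(𝒜(S), Kτ)`-homogeneous (KZ Observation 8's computation) — with its reduced forms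
  `isRelHomogeneousW_cellMatchings_of_dense`, `isRelHomogeneousW_cellCuts_of_dense`, and the Markov companion
  `sum_deficient_anchoredCores_le` (stars below `θ`× their share carry ≤ `θ` of the mass). The middle range (relative
  density between the sparsity threshold and `K⁻¹τ^{|S|}`) is NOT homogeneous in general and has to be re-homogenised by
  another round of the spread approximation inside the sub-star — whose own stars tile it without loss (§3);
* §6 (appended) PACKAGED FOR THE KERNEL LANE (`OddSet`/`PMatch`/`levelWeight`/`liftOdd`/`liftPMatch`/`IsPsdRect` currency): the
  anchored split of a cell `sum_pair_eq_sum_anchoredCores_split`, the non-crossing sub-cell as a lifted cell of `K_m` with pattern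
  `π = V = verts S` (`sum_noncrossing_eq_sum_lift`, `cc_lift_anchored`: `cc` preserved, `isPsdRect_lift_anchored`,
  `anchored_cell_value_eq_lift`), and the crossing pins of the remainder (`exists_crossing_pin`);
* §7 (appended) the cut side of a Kupavskii–Zakharov PIECE on a non-crossing sub-cell, reduced, with the density dichotomy built in
  (`isRelHomogeneousW_oddCellCuts_piece_of_dense` — the `OddSet` twin of `isRelHomogeneousW_pmCellMatchings_piece`;
  `isRelHomogeneousW_supersets_of_dense_star`, `image_val_filter_mem_eq_odd`, `image_val_filter_subset_odd`).

References: Rothvoß 2017, §2 [Rothvoss2017] (cuts `δ(U)`, perfect matchings as edge sets, the pairs `Q_ℓ`);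
Kupavskii–Zakharov 2022, §2, Observation 8, Lemma 11 [KupavskiiZakharov2022] (stars `𝒜(S)`, relative homogeneity,
the spread approximation). No named fact is introduced; every statement is proved. WHAT THIS IS NOT: no estimate of the
cell's programme (none of S3/S4, no SNT), no claim that the alternating two-sided refinement terminates, nothing about
`TracialDecayExp20` or psd rank, no P-vs-NP content. Label: instrument (Literature glue).
-/

noncomputable section

namespace Literature.Combinatorics.AssociationSchemes.CutMatchingRestrictionCutCores

open Finset
open Literature.Barriers.PneNP
open Literature.Combinatorics.SetFamily
open Literature.Combinatorics.SimpleGraph.CycleSpace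
open Literature.Combinatorics.AssociationSchemes.HomogeneousMatchingFamilies
open Literature.Combinatorics.AssociationSchemes.CutMatchingRestriction
open Literature.Combinatorics.AssociationSchemes.CutMatchingRestrictionStrategies

/-! ## §1 The edges of a matching at a vertex set -/

section Generic

variable {α : Type*} [DecidableEq α]

/-- **The edges of `M` at the vertex set `R`**: the members of `M` with at least one endpoint in `R`
(for a perfect matching `M ⊇` these are "M's edges at the pinned set" — the matching-side core that pinning
`R` into the cut induces). [cite: KupavskiiZakharov2022, §2 (p. 6: stars `𝒜(S)`; here `S` = the edges at `R`)] -/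
def edgesAt (R : Finset α) (M : Finset (Sym2 α)) : Finset (Sym2 α) := M.filter fun e => ∃ a ∈ R, a ∈ e

/-- Membership in `edgesAt`. [cite: KupavskiiZakharov2022, §2 (p. 6)] -/
theorem mem_edgesAt {R : Finset α} {M : Finset (Sym2 α)} {e : Sym2 α} :
    e ∈ edgesAt R M ↔ e ∈ M ∧ ∃ a ∈ R, a ∈ e := mem_filter

/-- `edgesAt R M ⊆ M`. [cite: KupavskiiZakharov2022, §2 (p. 6)] -/
theorem edgesAt_subset (R : Finset α) (M : Finset (Sym2 α)) : edgesAt R M ⊆ M := filter_subset _ _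

/-- `edgesAt` is monotone in the vertex set. [cite: KupavskiiZakharov2022, §2 (p. 6)] -/
theorem edgesAt_mono {R R' : Finset α} (h : R ⊆ R') (M : Finset (Sym2 α)) : edgesAt R M ⊆ edgesAt R' M :=
  fun e he => by
    obtain ⟨heM, a, ha, hae⟩ := mem_edgesAt.1 he
    exact mem_edgesAt.2 ⟨heM, a, h ha, hae⟩

/-- No vertices pinned, no edges. [cite: KupavskiiZakharov2022, §2 (p. 6)] -/
@[simp] theorem edgesAt_empty (M : Finset (Sym2 α)) : edgesAt ∅ M = ∅ :=
  filter_eq_empty_iff.2 fun e _ ⟨a, ha, _⟩ => by simp at ha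

/-- Every edge of `edgesAt R M` meets `R`. [cite: KupavskiiZakharov2022, §2 (p. 6)] -/
theorem meets_of_mem_edgesAt {R : Finset α} {M : Finset (Sym2 α)} {e : Sym2 α} (he : e ∈ edgesAt R M) :
    ∃ a ∈ R, a ∈ e := (mem_edgesAt.1 he).2

/-- `edgesAt R M` is the union over `a ∈ R` of the edges of `M` at `a`. [cite: KupavskiiZakharov2022, §2 (p. 6)] -/
theorem edgesAt_eq_biUnion (R : Finset α) (M : Finset (Sym2 α)) :
    edgesAt R M = R.biUnion fun a => M.filter fun e => a ∈ e := by
  ext e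
  simp only [mem_edgesAt, mem_biUnion, mem_filter]
  constructor
  · rintro ⟨he, a, ha, hae⟩
    exact ⟨a, ha, he, hae⟩
  · rintro ⟨a, ha, he, hae⟩
    exact ⟨he, a, ha, hae⟩

/-- A matching has at most `|R|` edges at `R` (one edge at each vertex of `R ⊆ Ω`).
[cite: Rothvoss2017, §2 (PDF p. 6: perfect matchings as edge sets)] -/
theorem card_edgesAt_le {Ω R : Finset α} {M : Finset (Sym2 α)} (hM : IsPMOn Ω M) (hR : R ⊆ Ω) :
    (edgesAt R M).card ≤ R.card := by
  rw [edgesAt_eq_biUnion]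
  refine card_biUnion_le.trans ?_
  rw [card_eq_sum_ones R]
  exact sum_le_sum fun a ha => (hM.card_filter (hR ha)).le

/-- Every pinned vertex lies on an edge at the pinned set. [cite: Rothvoss2017, §2 (PDF p. 6: perfect matchings as edge sets)] -/
theorem exists_mem_edgesAt {Ω R : Finset α} {M : Finset (Sym2 α)} (hM : IsPMOn Ω M) (hR : R ⊆ Ω) {a : α}
    (ha : a ∈ R) : ∃ e ∈ edgesAt R M, a ∈ e := by
  obtain ⟨e, he, hae⟩ := hM.exists_mem (hR ha)
  exact ⟨e, mem_edgesAt.2 ⟨he, a, ha, hae⟩, hae⟩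

/-- **The fibre of `edgesAt R` is a star.** Let `S` be a perfect matching of `V ⊇ R` every edge of which meets
`R` (an ANCHORED core at `R`). Then for every perfect matching `M` (of any `Ω`) containing `S`, the edges of `M`
at `R` are exactly `S`. [cite: KupavskiiZakharov2022, §2 (p. 6: the star `𝒜(S) = {M : S ⊆ M}`)] -/
theorem edgesAt_eq_of_subset {Ω V R : Finset α} {S M : Finset (Sym2 α)} (hS : IsPMOn V S) (hRV : R ⊆ V)
    (hSR : ∀ e ∈ S, ∃ a ∈ R, a ∈ e) (hM : IsPMOn Ω M) (hSM : S ⊆ M) : edgesAt R M = S := by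
  ext e
  rw [mem_edgesAt]
  constructor
  · rintro ⟨heM, a, ha, hae⟩
    obtain ⟨e', he'S, hae'⟩ := hS.exists_mem (hRV ha)
    rwa [hM.unique heM (hSM he'S) hae hae']
  · intro heS
    exact ⟨hSM heS, hSR e heS⟩

/-- … and conversely `edgesAt R M = S` forces `S ⊆ M`; so on perfect matchings the fibre
`{M : edgesAt R M = S}` of an anchored core `S` is the star `{M : S ⊆ M}`.
[cite: KupavskiiZakharov2022, §2 (p. 6: the star `𝒜(S)`)] -/
theorem edgesAt_eq_iff_subset {Ω V R : Finset α} {S M : Finset (Sym2 α)} (hS : IsPMOn V S) (hRV : R ⊆ V)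
    (hSR : ∀ e ∈ S, ∃ a ∈ R, a ∈ e) (hM : IsPMOn Ω M) : edgesAt R M = S ↔ S ⊆ M :=
  ⟨fun h => h ▸ edgesAt_subset R M, edgesAt_eq_of_subset hS hRV hSR hM⟩

/-! ## §2 Crossing an anchored core: `|δ(U) ∩ S| = |V(S) ∖ U|` for `R ⊆ U` -/

omit [DecidableEq α] in
/-- An edge with an endpoint in `U` crosses `U` iff it has an endpoint outside `U`.
[cite: Rothvoss2017, §2 (PDF p. 5: the cut `δ(U)`)] -/
theorem crosses_iff_exists_not_mem {U : Finset α} {e : Sym2 α} (he : ∃ a ∈ U, a ∈ e) :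
    Crosses U e ↔ ∃ v ∈ e, v ∉ U := by
  induction e using Sym2.ind with
  | h x y =>
    obtain ⟨a, haU, hae⟩ := he
    rw [crosses_mk]
    constructor
    · rintro (⟨-, hy⟩ | ⟨hx, -⟩)
      · exact ⟨y, Sym2.mem_mk_right x y, hy⟩
      · exact ⟨x, Sym2.mem_mk_left x y, hx⟩
    · rintro ⟨v, hv, hvU⟩
      rcases Sym2.mem_iff.1 hae with rfl | rfl <;> rcases Sym2.mem_iff.1 hv with rfl | rfl
      · exact absurd haU hvU
      · exact Or.inl ⟨haU, hvU⟩
      · exact Or.inr ⟨hvU, haU⟩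
      · exact absurd haU hvU

/-- **Crossing edges of an anchored core ↔ its vertices outside the cut.** Let `S` be a perfect matching of
`V` every edge of which meets `R`, and `R ⊆ U`. Then the edges of `S` crossing `U` are in bijection with the
vertices of `V` outside `U` (each such vertex lies on one edge of `S`, which meets `R ⊆ U` at its other end):
`crossCount U S = |V ∖ U|`. [cite: Rothvoss2017, §2 (PDF pp. 5–6: `|δ(U) ∩ M|`)] -/
theorem crossCount_eq_card_sdiff {V R U : Finset α} {S : Finset (Sym2 α)} (hS : IsPMOn V S)
    (hSR : ∀ e ∈ S, ∃ a ∈ R, a ∈ e) (hRU : R ⊆ U) : crossCount U S = (V \ U).card := by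
  have hmeet : ∀ e ∈ S, ∃ a ∈ U, a ∈ e := fun e he => by
    obtain ⟨a, ha, hae⟩ := hSR e he
    exact ⟨a, hRU ha, hae⟩
  -- the crossing edges are the union over `v ∈ V ∖ U` of the (single) edge of `S` at `v`
  have hfilter : S.filter (Crosses U) = (V \ U).biUnion fun v => S.filter fun e => v ∈ e := by
    ext e
    simp only [mem_filter, mem_biUnion, mem_sdiff]
    constructor
    · rintro ⟨heS, hc⟩
      obtain ⟨v, hve, hvU⟩ := (crosses_iff_exists_not_mem (hmeet e heS)).1 hc
      exact ⟨v, ⟨hS.mem_of_mem heS hve, hvU⟩, heS, hve⟩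
    · rintro ⟨v, ⟨-, hvU⟩, heS, hve⟩
      exact ⟨heS, (crosses_iff_exists_not_mem (hmeet e heS)).2 ⟨v, hve, hvU⟩⟩
  -- and these single edges are pairwise distinct: an edge of `S` has at most one endpoint outside `U`
  have hdisj : ∀ v ∈ V \ U, ∀ w ∈ V \ U, v ≠ w →
      Disjoint (S.filter fun e => v ∈ e) (S.filter fun e => w ∈ e) := by
    intro v hv w hw hvw
    rw [disjoint_left]
    intro e hev hew
    obtain ⟨heS, hve⟩ := mem_filter.1 hev
    obtain ⟨-, hwe⟩ := mem_filter.1 hew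
    obtain ⟨a, haU, hae⟩ := hmeet e heS
    induction e using Sym2.ind with
    | h x y =>
      rcases Sym2.mem_iff.1 hve with rfl | rfl <;> rcases Sym2.mem_iff.1 hwe with rfl | rfl
      · exact hvw rfl
      · rcases Sym2.mem_iff.1 hae with rfl | rfl
        · exact (mem_sdiff.1 hv).2 haU
        · exact (mem_sdiff.1 hw).2 haU
      · rcases Sym2.mem_iff.1 hae with rfl | rfl
        · exact (mem_sdiff.1 hw).2 haU
        · exact (mem_sdiff.1 hv).2 haU
      · exact hvw rfl
  rw [crossCount, hfilter, card_biUnion hdisj, card_eq_sum_ones (V \ U)]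
  exact sum_congr rfl fun v hv => hS.card_filter (mem_sdiff.1 hv).1

/-- Hence **an anchored core is not crossed iff its support lies inside the cut**: `crossCount U S = 0 ↔ V ⊆ U`
(`R ⊆ U`). [cite: Rothvoss2017, §2 (PDF pp. 5–6)] -/
theorem crossCount_eq_zero_iff_subset {V R U : Finset α} {S : Finset (Sym2 α)} (hS : IsPMOn V S)
    (hSR : ∀ e ∈ S, ∃ a ∈ R, a ∈ e) (hRU : R ⊆ U) : crossCount U S = 0 ↔ V ⊆ U := by
  rw [crossCount_eq_card_sdiff hS hSR hRU, card_eq_zero, sdiff_eq_empty_iff_subset]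

/-- The same read on the pattern `π = U ∩ V`: for `R ⊆ π ⊆ V`, `crossCount π S = |V| − |π|`; in particular the
only crossing-free pattern of an anchored core is the full pattern `π = V`. [cite: Rothvoss2017, §2 (PDF p. 6)] -/
theorem crossCount_pattern_eq {V R π : Finset α} {S : Finset (Sym2 α)} (hS : IsPMOn V S)
    (hSR : ∀ e ∈ S, ∃ a ∈ R, a ∈ e) (hRπ : R ⊆ π) (hπV : π ⊆ V) : crossCount π S = V.card - π.card := by
  rw [crossCount_eq_card_sdiff hS hSR hRπ, card_sdiff_of_subset hπV]

/-- If the support is not inside the cut, SOME edge of the anchored core crosses the cut (a crossing pin).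
[cite: Rothvoss2017, §2 (PDF pp. 5–6)] -/
theorem exists_crossing_of_not_subset {V R U : Finset α} {S : Finset (Sym2 α)} (hS : IsPMOn V S)
    (hSR : ∀ e ∈ S, ∃ a ∈ R, a ∈ e) (hRU : R ⊆ U) (hVU : ¬V ⊆ U) : ∃ e ∈ S, Crosses U e := by
  have hpos : crossCount U S ≠ 0 := fun h0 => hVU ((crossCount_eq_zero_iff_subset hS hSR hRU).1 h0)
  have hne : (S.filter (Crosses U)).Nonempty := by
    rw [← card_pos]
    exact Nat.pos_of_ne_zero hpos
  obtain ⟨e, he⟩ := hne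
  exact ⟨e, (mem_filter.1 he).1, (mem_filter.1 he).2⟩

/-- **The split along an anchored core.** For a perfect matching `M` of `Ω` containing the anchored core `S`
(perfect matching of `V ⊆ Ω`, every edge meeting `R`) and a cut `U` with `R ⊆ U ⊆ Ω`:
`crossCount U M = |V ∖ U| + crossCount (U ∖ V) (M ∖ S)`; on the non-crossing class `V ⊆ U` the first term vanishes.
[cite: Rothvoss2017, §2 (PDF pp. 5–6)] -/
theorem crossCount_split_anchored {Ω V R U : Finset α} {S M : Finset (Sym2 α)} (hV : V ⊆ Ω) (hS : IsPMOn V S)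
    (hSR : ∀ e ∈ S, ∃ a ∈ R, a ∈ e) (hM : IsPMOn Ω M) (hSM : S ⊆ M) (hRU : R ⊆ U) (hU : U ⊆ Ω) :
    crossCount U M = (V \ U).card + crossCount (U \ V) (M \ S) := by
  rw [crossCount_split hV hS hM hSM hU, ← crossCount_eq_crossCount_inter hS.subset_sym2,
    crossCount_eq_card_sdiff hS hSR hRU]

end Generic

/-! ## §3 `K_n`: the anchored cores at `R` and the partition of the perfect matchings by their edges at `R` -/

section Anchored

variable {n : ℕ}

/-- **The anchored cores at `R`**: `𝒮(R) = {edgesAt R M : M ∈ PM_n}`, the partial matchings that occur as the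
set of edges of a perfect matching of `K_n` at the pinned vertex set `R`.
[cite: KupavskiiZakharov2022, §2 (p. 6: stars `𝒜(S)` of partial matchings `S`)] -/
def anchoredCores (R : Finset (Fin n)) : Finset (Finset (Sym2 (Fin n))) :=
  (perfectMatchings univ).image (edgesAt R)

/-- Membership in `anchoredCores`. [cite: KupavskiiZakharov2022, §2 (p. 6)] -/
theorem mem_anchoredCores {R : Finset (Fin n)} {S : Finset (Sym2 (Fin n))} :
    S ∈ anchoredCores R ↔ ∃ M, IsPMOn univ M ∧ edgesAt R M = S := by
  simp only [anchoredCores, mem_image, mem_perfectMatchings]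

/-- `edgesAt R M ∈ 𝒮(R)` for a perfect matching `M`. [cite: KupavskiiZakharov2022, §2 (p. 6)] -/
theorem edgesAt_mem_anchoredCores (R : Finset (Fin n)) {M : Finset (Sym2 (Fin n))} (hM : IsPMOn univ M) :
    edgesAt R M ∈ anchoredCores R :=
  mem_anchoredCores.2 ⟨M, hM, rfl⟩

/-- An anchored core is a perfect matching of its support. [cite: Rothvoss2017, §2 (PDF p. 6: perfect matchings as edge sets)] -/
theorem isPMOn_verts_of_mem_anchoredCores {R : Finset (Fin n)} {S : Finset (Sym2 (Fin n))}
    (hS : S ∈ anchoredCores R) : IsPMOn (verts S) S := by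
  obtain ⟨M, hM, rfl⟩ := mem_anchoredCores.1 hS
  exact isPMOn_verts hM (edgesAt_subset R M)

/-- Every edge of an anchored core meets `R`. [cite: KupavskiiZakharov2022, §2 (p. 6)] -/
theorem meets_of_mem_anchoredCores {R : Finset (Fin n)} {S : Finset (Sym2 (Fin n))} (hS : S ∈ anchoredCores R) :
    ∀ e ∈ S, ∃ a ∈ R, a ∈ e := by
  obtain ⟨M, -, rfl⟩ := mem_anchoredCores.1 hS
  exact fun e he => meets_of_mem_edgesAt he

/-- The pinned set lies in the support of every anchored core. [cite: KupavskiiZakharov2022, §2 (p. 6)] -/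
theorem subset_verts_of_mem_anchoredCores {R : Finset (Fin n)} {S : Finset (Sym2 (Fin n))}
    (hS : S ∈ anchoredCores R) : R ⊆ verts S := by
  obtain ⟨M, hM, rfl⟩ := mem_anchoredCores.1 hS
  intro a ha
  obtain ⟨e, he, hae⟩ := exists_mem_edgesAt hM (subset_univ R) ha
  exact mem_verts.2 ⟨e, he, hae⟩

/-- An anchored core has at most `|R|` edges … [cite: KupavskiiZakharov2022, §2 (p. 6)] -/
theorem card_le_of_mem_anchoredCores {R : Finset (Fin n)} {S : Finset (Sym2 (Fin n))} (hS : S ∈ anchoredCores R) :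
    S.card ≤ R.card := by
  obtain ⟨M, hM, rfl⟩ := mem_anchoredCores.1 hS
  exact card_edgesAt_le hM (subset_univ R)

/-- `2|S| = |V|` for a perfect matching `S` of `V` (each edge has two endpoints in `V`, each vertex one edge).
[folklore] -/
private theorem two_mul_card_eq {V : Finset (Fin n)} {S : Finset (Sym2 (Fin n))} (hS : IsPMOn V S) :
    2 * S.card = V.card := by
  rw [hS.card_eq_sum_cutCount Subset.rfl, mul_comm, card_eq_sum_ones, sum_mul]
  refine sum_congr rfl fun e he => ?_
  induction e using Sym2.ind with
  | h a b =>
    rw [cutCount_mk, if_pos (hS.mem_of_mem he (Sym2.mem_mk_left a b)),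
      if_pos (hS.mem_of_mem he (Sym2.mem_mk_right a b))]
    rfl

/-- … its support has `2|S| ≤ 2|R|` vertices … [cite: Rothvoss2017, §2 (PDF p. 6)] -/
theorem card_verts_of_mem_anchoredCores {R : Finset (Fin n)} {S : Finset (Sym2 (Fin n))}
    (hS : S ∈ anchoredCores R) : (verts S).card = 2 * S.card :=
  (two_mul_card_eq (isPMOn_verts_of_mem_anchoredCores hS)).symm

/-- … and at least `|R|/2` edges (its support contains `R`). [cite: KupavskiiZakharov2022, §2 (p. 6)] -/
theorem card_le_two_mul_of_mem_anchoredCores {R : Finset (Fin n)} {S : Finset (Sym2 (Fin n))}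
    (hS : S ∈ anchoredCores R) : R.card ≤ 2 * S.card := by
  rw [← card_verts_of_mem_anchoredCores hS]
  exact card_le_card (subset_verts_of_mem_anchoredCores hS)

/-- **The fibre of an anchored core is its star**: for `S ∈ 𝒮(R)` and a perfect matching `M` of `K_n`,
`edgesAt R M = S ↔ S ⊆ M`. [cite: KupavskiiZakharov2022, §2 (p. 6: the star `𝒜(S)`)] -/
theorem edgesAt_eq_iff_subset_of_mem {R : Finset (Fin n)} {S M : Finset (Sym2 (Fin n))} (hS : S ∈ anchoredCores R)
    (hM : IsPMOn univ M) : edgesAt R M = S ↔ S ⊆ M :=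
  edgesAt_eq_iff_subset (isPMOn_verts_of_mem_anchoredCores hS) (subset_verts_of_mem_anchoredCores hS)
    (meets_of_mem_anchoredCores hS) hM

/-- The fibre of `edgesAt R` over `S ∈ 𝒮(R)` inside a family `Y` of perfect matchings is the star `Y(S)`.
[cite: KupavskiiZakharov2022, §2 (p. 6: `𝒜(S)`)] -/
theorem filter_edgesAt_eq_supersets {R : Finset (Fin n)} {S : Finset (Sym2 (Fin n))} (hS : S ∈ anchoredCores R)
    {Y : Finset (Finset (Sym2 (Fin n)))} (hY : Y ⊆ perfectMatchings univ) :
    (Y.filter fun M => edgesAt R M = S) = supersets Y S := by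
  ext M
  simp only [mem_filter, mem_supersets, and_congr_right_iff]
  exact fun hM => edgesAt_eq_iff_subset_of_mem hS (mem_perfectMatchings.1 (hY hM))

/-- Distinct anchored cores have disjoint stars (a perfect matching has only one set of edges at `R`).
[cite: KupavskiiZakharov2022, §2 (p. 6)] -/
theorem disjoint_supersets_of_ne {R : Finset (Fin n)} {S S' : Finset (Sym2 (Fin n))} (hS : S ∈ anchoredCores R)
    (hS' : S' ∈ anchoredCores R) (hne : S ≠ S') {Y : Finset (Finset (Sym2 (Fin n)))} (hY : Y ⊆ perfectMatchings univ) :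
    Disjoint (supersets Y S) (supersets Y S') := by
  rw [← filter_edgesAt_eq_supersets hS hY, ← filter_edgesAt_eq_supersets hS' hY, disjoint_filter]
  intro M _ h h'
  exact hne (h.symm.trans h')

/-- **THE PARTITION OF A MATCHING FAMILY BY ITS EDGES AT `R`, as a sum identity**: for a family `Y` of perfect
matchings of `K_n` and any summand `g`, `Σ_{M ∈ Y} g(M) = Σ_{S ∈ 𝒮(R)} Σ_{M ∈ Y, S ⊆ M} g(M)`.
[cite: KupavskiiZakharov2022, §2 (p. 6: the stars `𝒜(S)`)] -/
theorem sum_eq_sum_anchoredCores {β : Type*} [AddCommMonoid β] (R : Finset (Fin n))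
    {Y : Finset (Finset (Sym2 (Fin n)))} (hY : Y ⊆ perfectMatchings univ) (g : Finset (Sym2 (Fin n)) → β) :
    ∑ M ∈ Y, g M = ∑ S ∈ anchoredCores R, ∑ M ∈ supersets Y S, g M := by
  rw [← sum_fiberwise_of_maps_to (s := Y) (t := anchoredCores R) (g := edgesAt R)
    (fun M hM => edgesAt_mem_anchoredCores R (mem_perfectMatchings.1 (hY hM))) g]
  exact sum_congr rfl fun S hS => by rw [filter_edgesAt_eq_supersets hS hY]

/-- The partition, counted: `|Y| = Σ_{S ∈ 𝒮(R)} |Y(S)|`. [cite: KupavskiiZakharov2022, §2 (p. 6)] -/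
theorem card_eq_sum_anchoredCores (R : Finset (Fin n)) {Y : Finset (Finset (Sym2 (Fin n)))}
    (hY : Y ⊆ perfectMatchings univ) : Y.card = ∑ S ∈ anchoredCores R, (supersets Y S).card := by
  simpa only [card_eq_sum_ones] using sum_eq_sum_anchoredCores R hY fun _ => 1

/-- The partition, weighed: `y(Y) = Σ_{S ∈ 𝒮(R)} y(Y(S))` for every weight `y` — no mass is lost or double
counted when a matching family is split by its edges at the pinned set. [cite: KupavskiiZakharov2022, §2 (p. 6)] -/
theorem wmass_eq_sum_anchoredCores (R : Finset (Fin n)) {Y : Finset (Finset (Sym2 (Fin n)))}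
    (hY : Y ⊆ perfectMatchings univ) (y : Finset (Sym2 (Fin n)) → ℝ) :
    wmass y Y = ∑ S ∈ anchoredCores R, wmass y (supersets Y S) := by
  simp only [wmass_def]
  exact sum_eq_sum_anchoredCores R hY y

/-- **The star of an anchored core, counted in the reduced instance**: `|PM_n(S)| = |PM(univ ∖ verts S)|`, the number
of perfect matchings of the `n − 2|S|` remaining vertices. [cite: KupavskiiZakharov2022, §2 (p. 6: the link `𝒜(S)`)] -/
theorem card_supersets_perfectMatchings {S : Finset (Sym2 (Fin n))} (hS : IsPMOn (verts S) S) :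
    (supersets (perfectMatchings (univ : Finset (Fin n))) S).card = (perfectMatchings (univ \ verts S)).card := by
  rw [← card_link, link_perfectMatchings_eq hS (subset_univ _)]

/-- **No entropy is lost**: the stars of the anchored cores at `R` tile `PM_n`,
`Σ_{S ∈ 𝒮(R)} |PM(univ ∖ verts S)| = |PM_n|` — the shares `|PM_n(S)|/|PM_n|` of the sub-cells sum to `1`.
[cite: KupavskiiZakharov2022, §2 (p. 6)] -/
theorem sum_anchoredCores_card_perfectMatchings (R : Finset (Fin n)) :
    ∑ S ∈ anchoredCores R, (perfectMatchings (univ \ verts S)).card =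
      (perfectMatchings (univ : Finset (Fin n))).card := by
  rw [card_eq_sum_anchoredCores R (Subset.refl (perfectMatchings univ))]
  exact sum_congr rfl fun S hS => (card_supersets_perfectMatchings (isPMOn_verts_of_mem_anchoredCores hS)).symm

/-- **The partition in the kernel's currency** `PMatch n`: for `Y : Finset (PMatch n)` and any `g`,
`Σ_{M ∈ Y} g M = Σ_{S ∈ 𝒮(R)} Σ_{M ∈ Y, S ⊆ M} g M`. [cite: KupavskiiZakharov2022, §2 (p. 6)] -/
theorem sum_pmatch_eq_sum_anchoredCores {β : Type*} [AddCommMonoid β] (R : Finset (Fin n)) (Y : Finset (PMatch n))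
    (g : PMatch n → β) : ∑ M ∈ Y, g M = ∑ S ∈ anchoredCores R, ∑ M ∈ Y.filter (fun M => S ⊆ M.1), g M := by
  rw [← sum_fiberwise_of_maps_to (s := Y) (t := anchoredCores R) (g := fun M => edgesAt R M.1)
    (fun M _ => edgesAt_mem_anchoredCores R M.2) g]
  refine sum_congr rfl fun S hS => sum_congr ?_ fun _ _ => rfl
  ext M
  simp only [mem_filter, and_congr_right_iff]
  exact fun _ => edgesAt_eq_iff_subset_of_mem hS M.2

/-- **Joint cores**: a matching-side core `S₀ ⊆ M` and the edges of `M` at `R` together form a partial matching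
`S₀ ∪ edgesAt R M ⊆ M`, a perfect matching of `verts S₀ ∪ verts (edgesAt R M)`; the sub-cell of the star of `S₀`
with prescribed edges `S` at `R` is the star of `S₀ ∪ S` (`supersets_supersets`).
[cite: KupavskiiZakharov2022, §3.1 (`𝒜(S)(S') = 𝒜(S ∪ S')`)] -/
theorem isPMOn_verts_union {S₀ S M : Finset (Sym2 (Fin n))} (hM : IsPMOn univ M) (h₀ : S₀ ⊆ M) (hS : S ⊆ M) :
    IsPMOn (verts (S₀ ∪ S)) (S₀ ∪ S) ∧ verts (S₀ ∪ S) = verts S₀ ∪ verts S := by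
  refine ⟨isPMOn_verts hM (union_subset h₀ hS), ?_⟩
  ext v
  simp only [mem_verts, mem_union]
  constructor
  · rintro ⟨e, he | he, hve⟩
    · exact Or.inl ⟨e, he, hve⟩
    · exact Or.inr ⟨e, he, hve⟩
  · rintro (⟨e, he, hve⟩ | ⟨e, he, hve⟩)
    · exact ⟨e, Or.inl he, hve⟩
    · exact ⟨e, Or.inr he, hve⟩

/-- The sub-cells of a star: `Σ_{M ∈ Y, S₀ ⊆ M} g M = Σ_{S ∈ 𝒮(R)} Σ_{M ∈ Y, S₀ ∪ S ⊆ M} g M`.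
[cite: KupavskiiZakharov2022, §3.1 (`𝒜(S)(S') = 𝒜(S ∪ S')`)] -/
theorem sum_supersets_eq_sum_anchoredCores {β : Type*} [AddCommMonoid β] (R : Finset (Fin n))
    {Y : Finset (Finset (Sym2 (Fin n)))} (hY : Y ⊆ perfectMatchings univ) (S₀ : Finset (Sym2 (Fin n)))
    (g : Finset (Sym2 (Fin n)) → β) :
    ∑ M ∈ supersets Y S₀, g M = ∑ S ∈ anchoredCores R, ∑ M ∈ supersets Y (S₀ ∪ S), g M := by
  rw [sum_eq_sum_anchoredCores R ((supersets_subset Y S₀).trans hY) g]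
  simp only [supersets_supersets]

/-- **Dichotomy for a cut containing the pinned set.** For `R ⊆ U` and a perfect matching `M` of `K_n` with edges
`S = edgesAt R M` at `R`: either `verts S ⊆ U` — then no edge of `S` crosses `U` and
`crossCount U M = crossCount (U ∖ verts S) (M ∖ S)` is the crossing count of the REDUCED pair — or some edge of
`S ⊆ M` crosses `U` (a crossing pin, killing virtual values at every dimension in the cell's programme).
[cite: Rothvoss2017, §2 (PDF pp. 5–6)] -/
theorem crossCount_eq_reduced_or_exists_crossing {R U : Finset (Fin n)} {M : Finset (Sym2 (Fin n))}
    (hM : IsPMOn univ M) (hRU : R ⊆ U) :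
    (verts (edgesAt R M) ⊆ U ∧
        crossCount U M = crossCount (U \ verts (edgesAt R M)) (M \ edgesAt R M)) ∨
      ∃ e ∈ edgesAt R M, Crosses U e := by
  have hS : IsPMOn (verts (edgesAt R M)) (edgesAt R M) := isPMOn_verts hM (edgesAt_subset R M)
  have hSR : ∀ e ∈ edgesAt R M, ∃ a ∈ R, a ∈ e := fun e he => meets_of_mem_edgesAt he
  by_cases hVU : verts (edgesAt R M) ⊆ U
  · refine Or.inl ⟨hVU, ?_⟩
    rw [crossCount_split_anchored (subset_univ _) hS hSR hM (edgesAt_subset R M) hRU (subset_univ U),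
      sdiff_eq_empty_iff_subset.2 hVU, card_empty, zero_add]
  · exact Or.inr (exists_crossing_of_not_subset hS hSR hRU hVU)

end Anchored

/-! ## §4 Cut-side weights: mass, stars, and Kupavskii–Zakharov homogeneity transport to the reduced instance -/

section CutWeights

variable {n m : ℕ}

/-- The lift of a reduced cut on the pattern class: `emb(emb⁻¹ U) ∪ π = U` when `U ∩ V = π`.
[cite: Rothvoss2017, §2 (PDF p. 6)] -/
theorem image_cutPullback_union {V π : Finset (Fin n)} (h : (univ \ V).card = m) {U : Finset (Fin n)}
    (hU : U ∩ V = π) : (cutPullback V h U).image (emb V h) ∪ π = U := by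
  rw [image_cutPullback, ← hU, sdiff_union_inter]

/-- **Mass of the pulled-back cut family under the reduced weight.** For a family `X` of vertex sets, a pattern
`π` on `V` and a weight `x` on vertex sets of `K_n`, the REDUCED WEIGHT `Ũ ↦ x(emb(Ũ) ∪ π)` gives the pulled-back
family `cellCuts X V π h` the mass `x({U ∈ X : U ∩ V = π})` of the pattern class (the pull-back is a bijection on
the pattern class, with inverse the lift). Matching-side companion: `wmass_cellMatchings`.
[cite: KupavskiiZakharov2022, §2 (p. 6: renaming the ground set)] [cite: Rothvoss2017, §2 (PDF p. 6)] -/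
theorem wmass_cellCuts {V π : Finset (Fin n)} (h : (univ \ V).card = m) (X : Finset (Finset (Fin n)))
    (x : Finset (Fin n) → ℝ) :
    wmass (fun Ut => x (Ut.image (emb V h) ∪ π)) (cellCuts X V π h) = wmass x (cutsWith X V π) := by
  unfold wmass
  rw [cellCuts, sum_image fun U₁ h₁ U₂ h₂ heq =>
    cutPullback_injOn h (mem_cutsWith.1 h₁).2 (mem_cutsWith.1 h₂).2 heq]
  exact sum_congr rfl fun U hU => by rw [image_cutPullback_union h (mem_cutsWith.1 hU).2]

/-- A set of reduced vertices lies in `emb⁻¹ U` iff its image lies in `U`. [cite: Rothvoss2017, §2 (PDF p. 6)] -/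
theorem subset_cutPullback_iff {V : Finset (Fin n)} (h : (univ \ V).card = m) {U : Finset (Fin n)}
    {Tt : Finset (Fin m)} : Tt ⊆ cutPullback V h U ↔ Tt.image (emb V h) ⊆ U := by
  rw [image_subset_iff]
  exact forall₂_congr fun i _ => mem_cutPullback

/-- A set of reduced vertices avoids `emb⁻¹ U` iff its image avoids `U`. [cite: Rothvoss2017, §2 (PDF p. 6)] -/
theorem disjoint_cutPullback_iff {V : Finset (Fin n)} (h : (univ \ V).card = m) {U : Finset (Fin n)}
    {Nt : Finset (Fin m)} : Disjoint Nt (cutPullback V h U) ↔ Disjoint (Nt.image (emb V h)) U := by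
  rw [disjoint_left, disjoint_left]
  constructor
  · intro hd x hx hxU
    obtain ⟨i, hi, rfl⟩ := mem_image.1 hx
    exact hd hi (mem_cutPullback.2 hxU)
  · intro hd i hi hiU
    exact hd (mem_image_of_mem _ hi) (mem_cutPullback.1 hiU)

end CutWeights

section CutWeightsGeneric

variable {α : Type*} [DecidableEq α]

/-- Stars commute with pattern classes: `{U ∈ X : U ∩ V = π}(T) = {U ∈ X(T) : U ∩ V = π}`.
[cite: KupavskiiZakharov2022, §3.1 (`𝒜(S)(S') = 𝒜(S ∪ S')`)] -/
theorem supersets_cutsWith (X : Finset (Finset α)) (V π T : Finset α) :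
    supersets (cutsWith X V π) T = cutsWith (supersets X T) V π := by
  ext U
  simp only [mem_supersets, mem_cutsWith]
  tauto

/-- Pattern classes are idempotent. [cite: Rothvoss2017, §2 (PDF p. 6)] -/
theorem cutsWith_cutsWith (X : Finset (Finset α)) (V π : Finset α) : cutsWith (cutsWith X V π) V π = cutsWith X V π := by
  ext U
  simp only [mem_cutsWith]
  tauto

/-- A family inside a pattern class is its own pattern class. [cite: Rothvoss2017, §2 (PDF p. 6)] -/
theorem cutsWith_eq_self_of_subset {𝒢 X : Finset (Finset α)} {V π : Finset α} (h : 𝒢 ⊆ cutsWith X V π) :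
    cutsWith 𝒢 V π = 𝒢 :=
  filter_true_of_mem fun _ hU => (mem_cutsWith.1 (h hU)).2

/-- **Refining a pattern**: prescribing the pattern on a larger set `V' ⊇ V` (compatibly, `π' ∩ V = π`) selects a
sub-class: `{U ∈ X : U ∩ V' = π'} = {U ∈ {U ∈ X : U ∩ V = π} : U ∩ V' = π'}`. [cite: Rothvoss2017, §2 (PDF p. 6)] -/
theorem cutsWith_refine {X : Finset (Finset α)} {V π V' π' : Finset α} (hV : V ⊆ V') (hπ : π' ∩ V = π) :
    cutsWith X V' π' = cutsWith (cutsWith X V π) V' π' := by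
  ext U
  simp only [mem_cutsWith]
  constructor
  · rintro ⟨hUX, hUV'⟩
    refine ⟨⟨hUX, ?_⟩, hUV'⟩
    rw [← hπ, ← hUV', inter_assoc, inter_eq_right.2 hV]
  · rintro ⟨⟨hUX, -⟩, hUV'⟩
    exact ⟨hUX, hUV'⟩

/-- A pattern class in "pins in / pins out" form: for disjoint `P`, `N`, `{U ∈ X : U ∩ (P ∪ N) = P} = {U ∈ X : P ⊆ U, N ∩ U = ∅}`.
[cite: Rothvoss2017, §2 (PDF p. 6)] -/
theorem mem_cutsWith_union_iff {X : Finset (Finset α)} {P N U : Finset α} (hPN : Disjoint P N) :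
    U ∈ cutsWith X (P ∪ N) P ↔ U ∈ X ∧ P ⊆ U ∧ Disjoint N U := by
  rw [mem_cutsWith, and_congr_right_iff]
  intro _
  constructor
  · intro h
    refine ⟨fun a ha => ?_, disjoint_left.2 fun a haN haU => ?_⟩
    · have : a ∈ U ∩ (P ∪ N) := h.symm ▸ ha
      exact (mem_inter.1 this).1
    · have : a ∈ U ∩ (P ∪ N) := mem_inter.2 ⟨haU, mem_union_right _ haN⟩
      rw [h] at this
      exact disjoint_left.1 hPN this haN
  · rintro ⟨hPU, hNU⟩
    ext a
    simp only [mem_inter, mem_union]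
    constructor
    · rintro ⟨haU, haP | haN⟩
      · exact haP
      · exact absurd haU (disjoint_left.1 hNU haN)
    · intro haP
      exact ⟨hPU haP, Or.inl haP⟩

/-- Stars are pattern classes with no pins out: `X(T) = {U ∈ X : U ∩ T = T}`. [cite: KupavskiiZakharov2022, §2 (p. 6)] -/
theorem supersets_eq_cutsWith (X : Finset (Finset α)) (T : Finset α) : supersets X T = cutsWith X T T := by
  ext U
  simp only [mem_supersets, mem_cutsWith, inter_eq_right]

end CutWeightsGeneric

section CutWeightsTransport

variable {n m : ℕ}

/-- **Stars commute with the pull-back** on a pattern class: the members of `cellCuts X V π h` containing `T̃` are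
the pull-backs of the members of the pattern class containing `emb(T̃)`. Matching-side companion:
`supersets_cellMatchings`. [cite: KupavskiiZakharov2022, §2 (p. 6: stars; renaming the ground set)] -/
theorem supersets_cellCuts (X : Finset (Finset (Fin n))) (V π : Finset (Fin n)) (h : (univ \ V).card = m)
    (Tt : Finset (Fin m)) :
    supersets (cellCuts X V π h) Tt = cellCuts (supersets X (Tt.image (emb V h))) V π h := by
  rw [cellCuts, cellCuts, supersets, filter_image, ← supersets_cutsWith, supersets]
  congr 1
  ext U
  simp only [mem_filter, subset_cutPullback_iff h]

/-- **Refined pattern classes commute with the pull-back**: pinning further reduced vertices `P̃` in and `Ñ` out of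
the reduced cuts is the pull-back of pinning `emb(P̃)` in and `emb(Ñ)` out (`P̃`, `Ñ` disjoint).
[cite: Rothvoss2017, §2 (PDF p. 6)] [cite: KupavskiiZakharov2022, §2 (p. 6: renaming the ground set)] -/
theorem cutsWith_cellCuts {X : Finset (Finset (Fin n))} {V π : Finset (Fin n)} (hπ : π ⊆ V)
    (h : (univ \ V).card = m) {Pt Nt : Finset (Fin m)} (hPN : Disjoint Pt Nt) :
    cutsWith (cellCuts X V π h) (Pt ∪ Nt) Pt =
      cellCuts (cutsWith X (V ∪ (Pt.image (emb V h) ∪ Nt.image (emb V h))) (π ∪ Pt.image (emb V h))) V π h := by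
  have hPN' : Disjoint (Pt.image (emb V h)) (Nt.image (emb V h)) := disjoint_image (emb_injective V h) |>.2 hPN
  have hPV : Disjoint (Pt.image (emb V h)) V := disjoint_left.2 fun x hx hxV => by
    obtain ⟨i, -, rfl⟩ := mem_image.1 hx
    exact emb_not_mem V h i hxV
  have hNV : Disjoint (Nt.image (emb V h)) V := disjoint_left.2 fun x hx hxV => by
    obtain ⟨i, -, rfl⟩ := mem_image.1 hx
    exact emb_not_mem V h i hxV
  ext Ut
  rw [mem_cutsWith_union_iff hPN, mem_cellCuts, mem_cellCuts]
  constructor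
  · rintro ⟨⟨U, hUX, hUV, rfl⟩, hPU, hNU⟩
    refine ⟨U, mem_cutsWith.2 ⟨hUX, ?_⟩, hUV, rfl⟩
    rw [subset_cutPullback_iff h] at hPU
    rw [disjoint_cutPullback_iff h] at hNU
    ext a
    simp only [mem_inter, mem_union]
    constructor
    · rintro ⟨haU, haV | haP | haN⟩
      · exact Or.inl (hUV ▸ mem_inter.2 ⟨haU, haV⟩)
      · exact Or.inr haP
      · exact absurd haU (disjoint_left.1 hNU haN)
    · rintro (haπ | haP)
      · exact ⟨(mem_inter.1 (hUV.symm ▸ haπ : a ∈ U ∩ V)).1, Or.inl (hπ haπ)⟩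
      · exact ⟨hPU haP, Or.inr (Or.inl haP)⟩
  · rintro ⟨U, hU, hUV, rfl⟩
    obtain ⟨hUX, hUV'⟩ := mem_cutsWith.1 hU
    refine ⟨⟨U, hUX, hUV, rfl⟩, ?_, ?_⟩
    · rw [subset_cutPullback_iff h]
      intro a haP
      have : a ∈ U ∩ (V ∪ (Pt.image (emb V h) ∪ Nt.image (emb V h))) := by
        rw [hUV']; exact mem_union_right _ haP
      exact (mem_inter.1 this).1
    · rw [disjoint_cutPullback_iff h, disjoint_left]
      intro a haN haU
      have : a ∈ U ∩ (V ∪ (Pt.image (emb V h) ∪ Nt.image (emb V h))) :=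
        mem_inter.2 ⟨haU, mem_union_right _ (mem_union_right _ haN)⟩
      rw [hUV', mem_union] at this
      rcases this with haπ | haP
      · exact disjoint_left.1 hNV haN (hπ haπ)
      · exact disjoint_left.1 hPN' haP haN

/-- The pull-back of a pattern class only depends on the pattern class. [cite: Rothvoss2017, §2 (PDF p. 6)] -/
theorem cellCuts_cutsWith (X : Finset (Finset (Fin n))) (V π : Finset (Fin n)) (h : (univ \ V).card = m) :
    cellCuts (cutsWith X V π) V π h = cellCuts X V π h := by
  rw [cellCuts, cutsWith_cutsWith, cellCuts]

/-- **KUPAVSKII–ZAKHAROV HOMOGENEITY OF A CUT WEIGHT TRANSPORTS TO THE REDUCED INSTANCE.** If a weight `x` on vertex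
sets of `K_n`, carried by a family `𝒢` of `t`-cuts with pattern `π` on `V` (`π ⊆ V`, `|π| ≤ t`), is `τ`-homogeneous
relative to the pattern class `{U : |U| = t, U ∩ V = π}` — e.g. the cut side of a cell after pinning the vertices of
`V` in (`π`) and out (`V ∖ π`) of the cut — then the reduced weight `Ũ ↦ x(emb(Ũ) ∪ π)` carried by the pulled-back
family `cellCuts 𝒢 V π h` is `τ`-homogeneous relative to ALL `(t − |π|)`-subsets of the reduced vertex set `Fin m`,
`m = n − |V|` (test a reduced set `T̃` through `emb(T̃)`; pattern classes and their stars pull back bijectively;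
masses by `wmass_cellCuts`). Matching-side companion: `isRelHomogeneousW_cellMatchings`.
[cite: KupavskiiZakharov2022, Lemma 11 (ii) and §2 (invariance under renaming the ground set)] -/
theorem isRelHomogeneousW_cellCuts {τ : ℝ} {V π : Finset (Fin n)} (hπ : π ⊆ V) (h : (univ \ V).card = m)
    {t : ℕ} (ht : π.card ≤ t) {𝒢 : Finset (Finset (Fin n))} (h𝒢 : 𝒢 ⊆ cutsWith (univ.powersetCard t) V π)
    {x : Finset (Fin n) → ℝ} (hhom : IsRelHomogeneousW τ (cutsWith (univ.powersetCard t) V π) x 𝒢) :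
    IsRelHomogeneousW τ (univ.powersetCard (t - π.card))
      (fun Ut : Finset (Fin m) => x (Ut.image (emb V h) ∪ π)) (cellCuts 𝒢 V π h) := by
  intro Tt
  set T : Finset (Fin n) := Tt.image (emb V h) with hTdef
  have hT : T.card = Tt.card := card_image_of_injective _ (emb_injective V h)
  set 𝒜 : Finset (Finset (Fin n)) := univ.powersetCard t with h𝒜def
  have h𝒢eq : cutsWith 𝒢 V π = 𝒢 := cutsWith_eq_self_of_subset h𝒢
  have h1 : supersets (cellCuts 𝒢 V π h) Tt = cellCuts (supersets 𝒢 T) V π h := supersets_cellCuts 𝒢 V π h Tt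
  have h2 : wmass (fun Ut : Finset (Fin m) => x (Ut.image (emb V h) ∪ π)) (cellCuts (supersets 𝒢 T) V π h) =
      wmass x (supersets 𝒢 T) := by
    rw [wmass_cellCuts, ← supersets_cutsWith, h𝒢eq]
  have h3 : ((univ.powersetCard (t - π.card) : Finset (Finset (Fin m))).card : ℝ) = (cutsWith 𝒜 V π).card := by
    rw [← cellCuts_powersetCard hπ h ht, card_cellCuts]
  have h4 : ((supersets (univ.powersetCard (t - π.card) : Finset (Finset (Fin m))) Tt).card : ℝ) =
      (supersets (cutsWith 𝒜 V π) T).card := by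
    rw [← cellCuts_powersetCard hπ h ht, supersets_cellCuts, card_cellCuts, supersets_cutsWith]
  have h5 : wmass (fun Ut : Finset (Fin m) => x (Ut.image (emb V h) ∪ π)) (cellCuts 𝒢 V π h) = wmass x 𝒢 := by
    rw [wmass_cellCuts, h𝒢eq]
  rw [h1, h2, h3, h4, h5, ← hT]
  exact hhom T

/-- **The case of a vertex core pinned INTO the cut** (`V = π = W`: every vertex of `W` in `U`, nothing pinned out —
the non-crossing sub-cell of §3, `W = verts S`): if `x` carried by a family `𝒢` of `t`-cuts all containing `W` is
`τ`-homogeneous relative to the star `{U : |U| = t, W ⊆ U}` — a piece of the Kupavskii–Zakharov approximation of the cut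
side with core `W`, or a dense sub-star of one (`supersets_of_dense`, §5) — then the reduced weight `Ũ ↦ x(emb(Ũ) ∪ W)` on
the pulled-back family is `τ`-homogeneous relative to all `(t − |W|)`-cuts of `K_m`, `m = n − |W|`.
[cite: KupavskiiZakharov2022, Lemma 11 (ii) and §2 (invariance under renaming the ground set)] -/
theorem isRelHomogeneousW_cellCuts_star {τ : ℝ} {W : Finset (Fin n)} (h : (univ \ W).card = m) {t : ℕ}
    (ht : W.card ≤ t) {𝒢 : Finset (Finset (Fin n))} (h𝒢 : 𝒢 ⊆ supersets (univ.powersetCard t) W)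
    {x : Finset (Fin n) → ℝ} (hhom : IsRelHomogeneousW τ (supersets (univ.powersetCard t) W) x 𝒢) :
    IsRelHomogeneousW τ (univ.powersetCard (t - W.card))
      (fun Ut : Finset (Fin m) => x (Ut.image (emb W h) ∪ W)) (cellCuts 𝒢 W W h) := by
  rw [supersets_eq_cutsWith] at h𝒢 hhom
  exact isRelHomogeneousW_cellCuts Subset.rfl h ht h𝒢 hhom

/-! ### The kernel's currency: odd cuts `OddSet`, the lift `liftOdd`, zero-extended weights -/

/-- The `t`-cuts of `K_n` as vertex sets: forgetting the oddness certificate of `{U : OddSet n | |U| = t}` gives all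
`t`-subsets (`t` odd). [cite: Rothvoss2017, §2 (PDF p. 6: the cuts `U`, `|U|` odd)] -/
theorem image_val_filter_card_eq {t : ℕ} (hto : Odd t) :
    (univ.filter fun U : OddSet n => U.1.card = t).image Subtype.val = univ.powersetCard t := by
  ext U
  simp only [mem_image, mem_filter, mem_univ, true_and, mem_powersetCard, subset_univ]
  constructor
  · rintro ⟨U', hU', rfl⟩; exact hU'
  · intro hU; exact ⟨⟨U, hU ▸ hto⟩, hU, rfl⟩

/-- The underlying vertex sets of the reduced odd cuts are the reduced cut family (even pattern: every reduced cut is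
odd). Matching-side companion: `image_val_pmCellMatchings`. [cite: Rothvoss2017, §2 (PDF p. 6)] -/
theorem image_val_oddCellCuts (X : Finset (OddSet n)) {V π : Finset (Fin n)} (hπe : Even π.card)
    (h : (univ \ V).card = m) : (oddCellCuts X V π h).image Subtype.val = cellCuts (X.image Subtype.val) V π h := by
  ext Ut
  simp only [mem_image, oddCellCuts, mem_subtype]
  constructor
  · rintro ⟨U', hU', rfl⟩
    exact hU'
  · intro hUt
    exact ⟨⟨Ut, odd_of_mem_cellCuts hπe hUt⟩, hUt, rfl⟩

/-- **A weight on odd cuts, reduced, is that weight at the lift.** For `xO : OddSet n → ℝ` (e.g. the trace density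
`U ↦ tr(X_U)/r` of the cut side of a psd strategy) extended by `0` to all vertex sets, the reduced weight at an odd
cut `Ũ` of `K_m` is `xO (liftOdd Ũ)` — the reduced weight of this section is the trace density of the reduced strategy
`X ∘ liftOdd` of `CutMatchingRestrictionStrategies` §3. Matching-side companion: `dite_weight_lift`.
[cite: Rothvoss2017, §2 (PDF p. 6)] -/
theorem dite_weight_liftOdd {V π : Finset (Fin n)} (h : (univ \ V).card = m) (hπ : π ⊆ V) (hπe : Even π.card)
    (xO : OddSet n → ℝ) (Ut : OddSet m) :
    (fun U : Finset (Fin n) => if hU : Odd U.card then xO ⟨U, hU⟩ else 0)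
        (Ut.1.image (emb V h) ∪ π) = xO (liftOdd V π h hπ hπe Ut) := by
  simp only [liftOdd]
  rw [dif_pos]

/-- The mass of a family `X : Finset (OddSet n)` under the zero-extended weight is `Σ_{U ∈ X} xO U`.
Matching-side companion: `wmass_image_val_dite`. [cite: Rothvoss2017, §2 (PDF p. 6)] -/
theorem wmass_image_val_dite_odd (xO : OddSet n → ℝ) (X : Finset (OddSet n)) :
    wmass (fun U : Finset (Fin n) => if hU : Odd U.card then xO ⟨U, hU⟩ else 0) (X.image Subtype.val) =
      ∑ U ∈ X, xO U := by
  unfold wmass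
  rw [sum_image fun _ _ _ _ hxy => Subtype.val_injective hxy]
  refine sum_congr rfl fun U _ => ?_
  rw [dif_pos U.2]

/-- **The reduced cut side of a cell, kernel currency**: for a family `X : Finset (OddSet n)` of `t`-cuts with even
pattern `π ⊆ V` (`|π| ≤ t`, `t` odd) whose zero-extended weight `xO` is `τ`-homogeneous relative to the pattern class
of the `t`-cuts, the reduced weight `xO ∘ liftOdd` carried by `oddCellCuts X V π h` is, as a weight on vertex sets of
`K_m`, `τ`-homogeneous relative to all `(t − |π|)`-cuts, and has the same mass.
[cite: KupavskiiZakharov2022, Lemma 11 (ii) and §2 (renaming the ground set)] -/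
theorem isRelHomogeneousW_oddCellCuts {τ : ℝ} {V π : Finset (Fin n)} (hπ : π ⊆ V) (hπe : Even π.card)
    (h : (univ \ V).card = m) {t : ℕ} (ht : π.card ≤ t) (X : Finset (OddSet n))
    (hX : X.image Subtype.val ⊆ cutsWith (univ.powersetCard t) V π) (xO : OddSet n → ℝ)
    (hhom : IsRelHomogeneousW τ (cutsWith (univ.powersetCard t) V π)
      (fun U : Finset (Fin n) => if hU : Odd U.card then xO ⟨U, hU⟩ else 0) (X.image Subtype.val)) :
    IsRelHomogeneousW τ (univ.powersetCard (t - π.card))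
        (fun Ut : Finset (Fin m) => if hU : Odd Ut.card then xO (liftOdd V π h hπ hπe ⟨Ut, hU⟩) else 0)
        ((oddCellCuts X V π h).image Subtype.val) ∧
      wmass (fun Ut : Finset (Fin m) => if hU : Odd Ut.card then xO (liftOdd V π h hπ hπe ⟨Ut, hU⟩) else 0)
          ((oddCellCuts X V π h).image Subtype.val) = ∑ U ∈ X.filter (fun U => U.1 ∩ V = π), xO U := by
  have key := isRelHomogeneousW_cellCuts hπ h ht hX hhom
  have hmass := wmass_cellCuts h (X.image Subtype.val) (π := π)
    (fun U : Finset (Fin n) => if hU : Odd U.card then xO ⟨U, hU⟩ else 0)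
  -- the two reduced weights agree on the reduced family (all its members are odd)
  have hagree : ∀ Ut ∈ cellCuts (X.image Subtype.val) V π h,
      (fun Ut : Finset (Fin m) => if hU : Odd Ut.card then xO (liftOdd V π h hπ hπe ⟨Ut, hU⟩) else 0) Ut =
        (fun Ut : Finset (Fin m) => if hU : Odd (Ut.image (emb V h) ∪ π).card then
          xO ⟨Ut.image (emb V h) ∪ π, hU⟩ else 0) Ut := by
    intro Ut hUt
    have hodd : Odd Ut.card := odd_of_mem_cellCuts hπe hUt
    have hodd' : Odd (Ut.image (emb V h) ∪ π).card := by
      rw [card_image_union h hπ]; exact hodd.add_even hπe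
    simp only
    rw [dif_pos hodd, dif_pos hodd']
    rfl
  have hw : ∀ P ⊆ cellCuts (X.image Subtype.val) V π h,
      wmass (fun Ut : Finset (Fin m) => if hU : Odd Ut.card then xO (liftOdd V π h hπ hπe ⟨Ut, hU⟩) else 0) P =
        wmass (fun Ut : Finset (Fin m) => if hU : Odd (Ut.image (emb V h) ∪ π).card then
          xO ⟨Ut.image (emb V h) ∪ π, hU⟩ else 0) P :=
    fun P hP => sum_congr rfl fun Ut hUt => hagree Ut (hP hUt)
  rw [image_val_oddCellCuts X hπe h]
  refine ⟨fun Tt => ?_, ?_⟩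
  · rw [hw _ (supersets_subset _ _), hw _ Subset.rfl]
    exact key Tt
  · rw [hw _ Subset.rfl, hmass, cutsWith, filter_image, wmass_image_val_dite_odd]

end CutWeightsTransport

/-! ## §5 Refining a homogeneous weight to a sub-star: what survives, quantitatively

Kupavskii–Zakharov homogeneity is a one-sided (upper-bound) condition: a `(𝒜, τ)`-homogeneous weight may
UNDER-weight a sub-star `𝒜(S)`, and inside an under-weighted sub-star nothing prevents concentration. Splitting a cell
by the other side's pins (a matching piece by the anchored cores at a vertex core `R`, §3; a cut piece by a finer
pattern) therefore keeps homogeneity only up to the RELATIVE DENSITY of the sub-class: a sub-star carrying at least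
`K⁻¹ · τ^{|S|}` times its ambient share is `(𝒜(S), Kτ)`-homogeneous (below), a sub-star of relative density
`< e^{-cD}` is sparse (trace marginals), and the middle range has to be re-homogenised (another round of the spread
approximation inside the sub-star, whose stars at `R` tile the ambient without loss by `sum_anchoredCores_card_perfectMatchings`).
This is the honest accounting asked for by the cell's psd programme (MEMO-14 §3 (2)); no estimate beyond it is claimed. -/

section Density

variable {α : Type*} [DecidableEq α]

/-- **A DENSE SUB-STAR OF A HOMOGENEOUS WEIGHT IS HOMOGENEOUS.** Let the weight `y ≥ 0` carried by `ℱ` be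
`(𝒜, τ)`-homogeneous (`τ ≥ 1`) and let the sub-star `ℱ(S)` carry at least `K⁻¹ τ^{|S|}` times its ambient share of the
mass: `τ^{|S|} · |𝒜(S)| · y(ℱ) ≤ K · y(ℱ(S)) · |𝒜|` (`K ≥ 1`; homogeneity is the reverse inequality with `K = 1`, so
`K` measures the deficit). Then `y` carried by `ℱ(S)` is `(𝒜(S), Kτ)`-homogeneous. (Printed one-line computation:
`y(ℱ(S ∪ T))/y(ℱ(S)) ≤ τ^{|S ∪ T|} (|𝒜(S ∪ T)|/|𝒜|) y(ℱ)/y(ℱ(S)) ≤ K τ^{|T|} |𝒜(S ∪ T)|/|𝒜(S)|`.)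
[cite: KupavskiiZakharov2022, §2 (definition of (𝒜, τ)-homogeneous) and Observation 8 (the same computation)] -/
theorem _root_.Literature.Combinatorics.SetFamily.IsRelHomogeneousW.supersets_of_dense {τ K : ℝ} (hτ : 1 ≤ τ) (hK : 1 ≤ K) {𝒜 ℱ : Finset (Finset α)}
    {y : Finset α → ℝ} (hy : ∀ A, 0 ≤ y A) (h : IsRelHomogeneousW τ 𝒜 y ℱ) {S : Finset α}
    (hdense : τ ^ S.card * (supersets 𝒜 S).card * wmass y ℱ ≤ K * (wmass y (supersets ℱ S) * 𝒜.card)) :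
    IsRelHomogeneousW (K * τ) (supersets 𝒜 S) y (supersets ℱ S) := by
  have hτ0 : 0 ≤ τ := zero_le_one.trans hτ
  have hK0 : 0 ≤ K := zero_le_one.trans hK
  have hKτ : 1 ≤ K * τ := one_le_mul_of_one_le_of_one_le hK hτ
  intro T
  rw [supersets_supersets, supersets_supersets]
  have hFS0 : 0 ≤ wmass y (supersets ℱ S) := wmass_nonneg hy _
  by_cases hTS : S ∪ T = S
  · rw [hTS]
    calc wmass y (supersets ℱ S) * ((supersets 𝒜 S).card : ℝ)
        = 1 * (supersets 𝒜 S).card * wmass y (supersets ℱ S) := by ring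
      _ ≤ (K * τ) ^ T.card * (supersets 𝒜 S).card * wmass y (supersets ℱ S) :=
        mul_le_mul_of_nonneg_right (mul_le_mul_of_nonneg_right (one_le_pow₀ hKτ) (Nat.cast_nonneg _)) hFS0
  -- `T ⊄ S`, so `T` is nonempty
  have hT1 : 1 ≤ T.card := by
    rw [Nat.one_le_iff_ne_zero, Ne, card_eq_zero]
    rintro rfl
    exact hTS (union_empty S)
  have hRHS0 : 0 ≤ (K * τ) ^ T.card * ((supersets 𝒜 (S ∪ T)).card : ℝ) * wmass y (supersets ℱ S) :=
    mul_nonneg (mul_nonneg (pow_nonneg (mul_nonneg hK0 hτ0) _) (Nat.cast_nonneg _)) hFS0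
  -- degenerate cases: empty ambient family or zero total mass
  rcases 𝒜.eq_empty_or_nonempty with h𝒜0 | h𝒜ne
  · subst h𝒜0
    simp only [supersets_emptyFamily, card_empty, Nat.cast_zero, mul_zero, zero_mul, le_refl]
  have hA : (0 : ℝ) < 𝒜.card := by exact_mod_cast h𝒜ne.card_pos
  by_cases hF0 : wmass y ℱ = 0
  · have : wmass y (supersets ℱ (S ∪ T)) = 0 := wmass_eq_zero_of_subset hy (supersets_subset _ _) hF0
    rw [this, zero_mul]
    exact hRHS0
  have hF : 0 < wmass y ℱ := lt_of_le_of_ne (wmass_nonneg hy _) (Ne.symm hF0)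
  have hτS : 0 < τ ^ S.card := pow_pos (zero_lt_one.trans_le hτ) _
  have h1 := h (S ∪ T)
  -- the exponent bookkeeping: `K τ^{|S ∪ T|} ≤ (Kτ)^{|T|} τ^{|S|}`
  have h3 : K * τ ^ (S ∪ T).card ≤ (K * τ) ^ T.card * τ ^ S.card := by
    rw [mul_pow, mul_assoc, ← pow_add]
    exact mul_le_mul (le_self_pow₀ hK (by omega)) (pow_le_pow_right₀ hτ (by
      have := card_union_le S T; omega)) (pow_nonneg hτ0 _) (pow_nonneg hK0 _)
  refine le_of_mul_le_mul_right ?_ (mul_pos (mul_pos hA hF) hτS)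
  calc wmass y (supersets ℱ (S ∪ T)) * ((supersets 𝒜 S).card : ℝ) * (𝒜.card * wmass y ℱ * τ ^ S.card)
      = (wmass y (supersets ℱ (S ∪ T)) * 𝒜.card) * (τ ^ S.card * (supersets 𝒜 S).card * wmass y ℱ) := by ring
    _ ≤ (τ ^ (S ∪ T).card * (supersets 𝒜 (S ∪ T)).card * wmass y ℱ) * (K * (wmass y (supersets ℱ S) * 𝒜.card)) :=
        mul_le_mul h1 hdense (mul_nonneg (mul_nonneg hτS.le (Nat.cast_nonneg _)) hF.le)
          (mul_nonneg (mul_nonneg (pow_nonneg hτ0 _) (Nat.cast_nonneg _)) hF.le)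
    _ = (K * τ ^ (S ∪ T).card) * ((supersets 𝒜 (S ∪ T)).card * wmass y (supersets ℱ S) * (𝒜.card * wmass y ℱ)) := by
        ring
    _ ≤ ((K * τ) ^ T.card * τ ^ S.card) * ((supersets 𝒜 (S ∪ T)).card * wmass y (supersets ℱ S) * (𝒜.card * wmass y ℱ)) :=
        mul_le_mul_of_nonneg_right h3 (mul_nonneg (mul_nonneg (Nat.cast_nonneg _) hFS0) (mul_nonneg hA.le hF.le))
    _ = (K * τ) ^ T.card * ((supersets 𝒜 (S ∪ T)).card : ℝ) * wmass y (supersets ℱ S) *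
          (𝒜.card * wmass y ℱ * τ ^ S.card) := by ring

/-- The set version (`y ≡ 1`): a sub-star `ℱ(S)` with `τ^{|S|} |𝒜(S)| |ℱ| ≤ K |ℱ(S)| |𝒜|` of a `(𝒜, τ)`-homogeneous family
is `(𝒜(S), Kτ)`-homogeneous. [cite: KupavskiiZakharov2022, §2 and Observation 8] -/
theorem _root_.Literature.Combinatorics.SetFamily.IsRelHomogeneous.supersets_of_dense {τ K : ℝ} (hτ : 1 ≤ τ) (hK : 1 ≤ K) {𝒜 ℱ : Finset (Finset α)}
    (h : IsRelHomogeneous τ 𝒜 ℱ) {S : Finset α}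
    (hdense : τ ^ S.card * (supersets 𝒜 S).card * (ℱ.card : ℝ) ≤ K * ((supersets ℱ S).card * 𝒜.card)) :
    IsRelHomogeneous (K * τ) (supersets 𝒜 S) (supersets ℱ S) := by
  rw [← isRelHomogeneousW_one_iff] at h ⊢
  refine h.supersets_of_dense hτ hK (fun _ => zero_le_one) ?_
  simpa only [wmass_one] using hdense

/-- **Deficient sub-classes carry little mass** (the companion Markov bound). If `ℱ` is split into classes `ℱ_i`
(`i ∈ I`, pairwise disjoint inside `ℱ`) with ambient shares `s_i ≥ 0`, `Σ_i s_i ≤ 1`, then the classes whose mass is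
below `θ · s_i · y(ℱ)` carry, in total, at most `θ · y(ℱ)`. [folklore] -/
private theorem sum_filter_lt_le {ι : Type*} (I : Finset ι) (w s : ι → ℝ) {θ M : ℝ} (hθ : 0 ≤ θ) (hM : 0 ≤ M)
    (hs : ∀ i ∈ I, 0 ≤ s i) (hsum : ∑ i ∈ I, s i ≤ 1) :
    ∑ i ∈ I.filter (fun i => w i < θ * s i * M), w i ≤ θ * M := by
  calc ∑ i ∈ I.filter (fun i => w i < θ * s i * M), w i
      ≤ ∑ i ∈ I.filter (fun i => w i < θ * s i * M), θ * s i * M :=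
        sum_le_sum fun i hi => (mem_filter.1 hi).2.le
    _ ≤ ∑ i ∈ I, θ * s i * M :=
        sum_le_sum_of_subset_of_nonneg (filter_subset _ _) fun i hi _ =>
          mul_nonneg (mul_nonneg hθ (hs i hi)) hM
    _ = θ * M * ∑ i ∈ I, s i := by rw [mul_sum]; exact sum_congr rfl fun i _ => by ring
    _ ≤ θ * M * 1 := mul_le_mul_of_nonneg_left hsum (mul_nonneg hθ hM)
    _ = θ * M := mul_one _

end Density

section DensityMatchings

variable {n : ℕ}

/-- **Splitting a matching family by its edges at `R`: the deficient stars carry little mass.** For a family `Y` of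
perfect matchings of `K_n` with a weight `y`, and `θ ≥ 0`: the anchored cores `S ∈ 𝒮(R)` whose star in `Y` carries
less than `θ · (|PM_n(S)|/|PM_n|) · y(Y)` have total mass at most `θ · y(Y)` (the shares `|PM_n(S)|/|PM_n|` sum to `1` by
`sum_anchoredCores_card_perfectMatchings`). [cite: KupavskiiZakharov2022, §2 (p. 6: the stars `𝒜(S)`)] -/
theorem sum_deficient_anchoredCores_le (R : Finset (Fin n)) {Y : Finset (Finset (Sym2 (Fin n)))}
    (hY : Y ⊆ perfectMatchings univ) {y : Finset (Sym2 (Fin n)) → ℝ} (hy : ∀ A, 0 ≤ y A) {θ : ℝ} (hθ : 0 ≤ θ) :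
    ∑ S ∈ (anchoredCores R).filter (fun S => wmass y (supersets Y S) <
        θ * ((supersets (perfectMatchings (univ : Finset (Fin n))) S).card /
          (perfectMatchings (univ : Finset (Fin n))).card : ℝ) * wmass y Y),
      wmass y (supersets Y S) ≤ θ * wmass y Y := by
  rcases Nat.eq_zero_or_pos (perfectMatchings (univ : Finset (Fin n))).card with h0 | hpos
  · -- no perfect matchings: `Y = ∅`, everything vanishes
    have hY0 : Y = ∅ := subset_empty.1 (card_eq_zero.1 h0 ▸ hY)
    subst hY0
    simp only [supersets_emptyFamily, wmass_empty, sum_const_zero, mul_zero, le_refl]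
  refine sum_filter_lt_le (anchoredCores R) (fun S => wmass y (supersets Y S))
    (fun S => ((supersets (perfectMatchings (univ : Finset (Fin n))) S).card : ℝ) /
      (perfectMatchings (univ : Finset (Fin n))).card) hθ (wmass_nonneg hy Y) (fun S _ => by positivity) ?_
  rw [← sum_div, div_le_one (by exact_mod_cast hpos), ← Nat.cast_sum, Nat.cast_le,
    card_eq_sum_anchoredCores R (Subset.refl (perfectMatchings univ))]

/-- **A dense star of a homogeneous matching weight, reduced, is homogeneous.** If the weight `y ≥ 0` carried by a
family `Y` of perfect matchings of `K_n` is `(PM_n, τ)`-homogeneous (`τ ≥ 1`) and the star of the anchored core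
`S ∈ 𝒮(R)` carries at least `K⁻¹ τ^{|S|}` of its share, then the reduced weight `M̃ ↦ y(S ∪ emb(M̃))` carried by the
pulled-back star `cellMatchings Y (verts S) S h` is `(PM_m, Kτ)`-homogeneous, `m = n − 2|S|`.
[cite: KupavskiiZakharov2022, Lemma 11 (ii) and Observation 8] -/
theorem isRelHomogeneousW_cellMatchings_of_dense {m : ℕ} {τ K : ℝ} (hτ : 1 ≤ τ) (hK : 1 ≤ K) {R : Finset (Fin n)}
    {S : Finset (Sym2 (Fin n))} (hS : S ∈ anchoredCores R) (h : (univ \ verts S).card = m)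
    {Y : Finset (Finset (Sym2 (Fin n)))} (hY : Y ⊆ perfectMatchings univ) {y : Finset (Sym2 (Fin n)) → ℝ}
    (hy : ∀ A, 0 ≤ y A) (hhom : IsRelHomogeneousW τ (perfectMatchings univ) y Y)
    (hdense : τ ^ S.card * (supersets (perfectMatchings (univ : Finset (Fin n))) S).card * wmass y Y ≤
      K * (wmass y (supersets Y S) * (perfectMatchings (univ : Finset (Fin n))).card)) :
    IsRelHomogeneousW (K * τ) (perfectMatchings (univ : Finset (Fin m)))
      (fun Mt => y (S ∪ Mt.image (Sym2.map (emb (verts S) h)))) (cellMatchings (supersets Y S) (verts S) S h) :=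
  isRelHomogeneousW_cellMatchings (isPMOn_verts_of_mem_anchoredCores hS) h ((supersets_subset _ _).trans hY)
    (fun _ hM => (mem_supersets.1 hM).2) (hhom.supersets_of_dense hτ hK hy hdense)

/-- **A dense sub-star of a homogeneous CUT weight, reduced, is homogeneous** (the cut side of a non-crossing sub-cell).
If the weight `x ≥ 0` carried by a family `𝒢` of `t`-cuts all containing the vertex core `R` is `τ`-homogeneous
relative to the star of `R` (a Kupavskii–Zakharov piece of the cut side, `τ ≥ 1`), `R ⊆ W` (`W = verts S` for an
anchored core `S ∈ 𝒮(R)`, `|W| ≤ t`), and the sub-star of `W` in `𝒢` carries at least `K⁻¹ τ^{|W ∖ R|}` of its share,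
then the reduced weight `Ũ ↦ x(emb(Ũ) ∪ W)` carried by the pull-back of `{U ∈ 𝒢 : W ⊆ U}` is `(Kτ)`-homogeneous relative
to all `(t − |W|)`-cuts of `K_m`, `m = n − |W|`. [cite: KupavskiiZakharov2022, Lemma 11 (ii) and Observation 8] -/
theorem isRelHomogeneousW_cellCuts_of_dense {m : ℕ} {τ K : ℝ} (hτ : 1 ≤ τ) (hK : 1 ≤ K) {R W : Finset (Fin n)}
    (hRW : R ⊆ W) (h : (univ \ W).card = m) {t : ℕ} (ht : W.card ≤ t) {𝒢 : Finset (Finset (Fin n))}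
    (h𝒢 : 𝒢 ⊆ supersets (univ.powersetCard t) R) {x : Finset (Fin n) → ℝ} (hx : ∀ U, 0 ≤ x U)
    (hhom : IsRelHomogeneousW τ (supersets (univ.powersetCard t) R) x 𝒢)
    (hdense : τ ^ (W \ R).card * (supersets (univ.powersetCard t : Finset (Finset (Fin n))) W).card * wmass x 𝒢 ≤
      K * (wmass x (supersets 𝒢 W) * (supersets (univ.powersetCard t : Finset (Finset (Fin n))) R).card)) :
    IsRelHomogeneousW (K * τ) (univ.powersetCard (t - W.card))
      (fun Ut : Finset (Fin m) => x (Ut.image (emb W h) ∪ W)) (cellCuts (supersets 𝒢 W) W W h) := by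
  have hRW' : R ∪ (W \ R) = W := union_sdiff_of_subset hRW
  -- the sub-star of `W` is the sub-star of `W ∖ R` inside the star of `R`
  have h1 : supersets 𝒢 W = supersets 𝒢 (W \ R) := by
    ext U
    simp only [mem_supersets, and_congr_right_iff]
    intro hU
    have hRU : R ⊆ U := (mem_supersets.1 (h𝒢 hU)).2
    constructor
    · exact fun hWU => sdiff_subset.trans hWU
    · intro hWRU a ha
      by_cases haR : a ∈ R
      · exact hRU haR
      · exact hWRU (mem_sdiff.2 ⟨ha, haR⟩)
  have h2 : supersets (univ.powersetCard t : Finset (Finset (Fin n))) W =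
      supersets (supersets (univ.powersetCard t) R) (W \ R) := by
    rw [supersets_supersets, hRW']
  rw [h1, h2] at hdense
  have key := hhom.supersets_of_dense hτ hK hx hdense
  rw [← h1, ← h2] at key
  exact isRelHomogeneousW_cellCuts_star h ht (supersets_mono (h𝒢.trans (supersets_subset _ _)) W) key

end DensityMatchings

/-! ## §6 (appended) Packaged for the kernel lane: the anchored split of a cell, the non-crossing sub-cells lifted, crossing pins

The symmetric reduction in the currency of the `ChebyshevTracialDesign*` Theorems files (`OddSet n`, `PMatch n`, `levelWeight`,
`liftOdd`/`liftPMatch`, `IsPsdRect`): split the matching side of a cell by the anchored cores at `R` and, inside each star, the cut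
side into the NON-CROSSING sub-cell (`verts S ⊆ U`, a sub-star) and the crossing remainder; the non-crossing sub-cell is the lift of
a cell of the reduced instance `K_m`, `m = n − 2|S|`, with pattern `π = V = verts S` (nothing pinned out), so `cc` and psd
rectangles are preserved exactly (`y = crossCount (verts S) S = 0`); in the crossing remainder every pair with `R ⊆ U` carries a
crossing pin `e ∈ S ⊆ M`. [cite: Rothvoss2017, §2 (PDF pp. 5–6)] [cite: KupavskiiZakharov2022, §2 (p. 6)] -/

section KernelPackaged

variable {n m : ℕ}

/-- The support of an anchored core has even size `2|S|`. [cite: Rothvoss2017, §2 (PDF p. 6)] -/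
theorem even_card_verts_of_mem_anchoredCores {R : Finset (Fin n)} {S : Finset (Sym2 (Fin n))} (hS : S ∈ anchoredCores R) :
    Even (verts S).card :=
  ⟨S.card, by rw [card_verts_of_mem_anchoredCores hS, two_mul]⟩

/-- An anchored core is not crossed by its own support: `crossCount (verts S) S = 0` (the full pattern is crossing-free).
[cite: Rothvoss2017, §2 (PDF pp. 5–6)] -/
theorem crossCount_verts_eq_zero {R : Finset (Fin n)} {S : Finset (Sym2 (Fin n))} (hS : S ∈ anchoredCores R) :
    crossCount (verts S) S = 0 :=
  (crossCount_eq_zero_iff_subset (isPMOn_verts_of_mem_anchoredCores hS) (meets_of_mem_anchoredCores hS)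
    (subset_verts_of_mem_anchoredCores hS)).2 Subset.rfl

/-- **THE ANCHORED SPLIT OF A CELL** (kernel currency). For families `A` of odd cuts and `B` of perfect matchings of `K_n`, a vertex
core `R` and any pair summand `g`: `Σ_{U ∈ A} Σ_{M ∈ B} g = Σ_{S ∈ 𝒮(R)} (Σ_{U ∈ A, U ∩ verts S = verts S} Σ_{M ∈ B, S ⊆ M} g
+ Σ_{U ∈ A, ¬ verts S ⊆ U} Σ_{M ∈ B, S ⊆ M} g)` — the non-crossing sub-cell (a sub-star on the cut side) and the crossing remainder of
each star. [cite: KupavskiiZakharov2022, §2 (p. 6: the stars `𝒜(S)`)] [cite: Rothvoss2017, §2 (PDF pp. 5–6)] -/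
theorem sum_pair_eq_sum_anchoredCores_split {β : Type*} [AddCommMonoid β] (R : Finset (Fin n)) (A : Finset (OddSet n))
    (B : Finset (PMatch n)) (g : OddSet n → PMatch n → β) :
    ∑ U ∈ A, ∑ M ∈ B, g U M =
      ∑ S ∈ anchoredCores R,
        (∑ U ∈ A.filter (fun U => U.1 ∩ verts S = verts S), ∑ M ∈ B.filter (fun M => S ⊆ M.1), g U M +
          ∑ U ∈ A.filter (fun U => ¬verts S ⊆ U.1), ∑ M ∈ B.filter (fun M => S ⊆ M.1), g U M) := by
  calc ∑ U ∈ A, ∑ M ∈ B, g U M = ∑ U ∈ A, ∑ S ∈ anchoredCores R, ∑ M ∈ B.filter (fun M => S ⊆ M.1), g U M :=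
        sum_congr rfl fun U _ => sum_pmatch_eq_sum_anchoredCores R B (g U)
    _ = ∑ S ∈ anchoredCores R, ∑ U ∈ A, ∑ M ∈ B.filter (fun M => S ⊆ M.1), g U M := sum_comm
    _ = _ := by
        refine sum_congr rfl fun S _ => ?_
        have hsplit : A.filter (fun U => U.1 ∩ verts S = verts S) = A.filter (fun U => verts S ⊆ U.1) :=
          filter_congr fun U _ => inter_eq_right
        rw [hsplit, ← sum_filter_add_sum_filter_not A (fun U => verts S ⊆ U.1)]

/-- **THE NON-CROSSING SUB-CELL IS A LIFTED CELL OF THE REDUCED INSTANCE.** For `S ∈ 𝒮(R)` with support `V = verts S`, `|univ ∖ V| = m`: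
`Σ_{U ∈ A, U ∩ V = V} Σ_{M ∈ B, S ⊆ M} g U M = Σ_{Ũ ∈ Ã} Σ_{M̃ ∈ B̃} g (liftOdd Ũ) (liftPMatch M̃)` over
`Ã = oddCellCuts A V V h`, `B̃ = pmCellMatchings B V S h` — `CutMatchingRestrictionStrategies.sum_cell_eq_sum_lift` with pattern `π = V`
(even, crossing-free). [cite: Rothvoss2017, §2 (PDF p. 6)] [cite: KupavskiiZakharov2022, §2 (p. 6)] -/
theorem sum_noncrossing_eq_sum_lift {β : Type*} [AddCommMonoid β] {R : Finset (Fin n)} {S : Finset (Sym2 (Fin n))}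
    (hS : S ∈ anchoredCores R) (h : (univ \ verts S).card = m) (A : Finset (OddSet n)) (B : Finset (PMatch n))
    (g : OddSet n → PMatch n → β) :
    ∑ U ∈ A.filter (fun U => U.1 ∩ verts S = verts S), ∑ M ∈ B.filter (fun M => S ⊆ M.1), g U M =
      ∑ Ut ∈ oddCellCuts A (verts S) (verts S) h, ∑ Mt ∈ pmCellMatchings B (verts S) S h,
        g (liftOdd (verts S) (verts S) h Subset.rfl (even_card_verts_of_mem_anchoredCores hS) Ut)
          (liftPMatch (verts S) S h (isPMOn_verts_of_mem_anchoredCores hS) Mt) :=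
  sum_cell_eq_sum_lift (isPMOn_verts_of_mem_anchoredCores hS) h Subset.rfl (even_card_verts_of_mem_anchoredCores hS) A B g

/-- On the non-crossing sub-cell the lift PRESERVES the crossing count: `cc (liftOdd Ũ) (liftPMatch M̃) = cc Ũ M̃` (`y = 0`), so tight
pairs lift to tight pairs. [cite: Rothvoss2017, §2 (PDF pp. 5–6)] -/
theorem cc_lift_anchored {R : Finset (Fin n)} {S : Finset (Sym2 (Fin n))} (hS : S ∈ anchoredCores R)
    (h : (univ \ verts S).card = m) (Ut : OddSet m) (Mt : PMatch m) :
    cc (liftOdd (verts S) (verts S) h Subset.rfl (even_card_verts_of_mem_anchoredCores hS) Ut)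
        (liftPMatch (verts S) S h (isPMOn_verts_of_mem_anchoredCores hS) Mt) = cc Ut Mt := by
  rw [cc_lift (isPMOn_verts_of_mem_anchoredCores hS) h Subset.rfl (even_card_verts_of_mem_anchoredCores hS),
    crossCount_verts_eq_zero hS, add_zero]

/-- **Psd rectangles restrict to psd rectangles on the non-crossing sub-cell of an anchored core** (every dimension `r`):
`CutMatchingRestrictionStrategies.IsPsdRect.lift` with `y = crossCount (verts S) S = 0`. [cite: BrietDadushPokutta2014, Thm. 6 (§3)]
[cite: Rothvoss2017, §2 (PDF p. 6)] -/
theorem isPsdRect_lift_anchored {r : ℕ} {R : Finset (Fin n)} {S : Finset (Sym2 (Fin n))} (hS : S ∈ anchoredCores R)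
    (h : (univ \ verts S).card = m) {X : OddSet n → Matrix (Fin r) (Fin r) ℝ} {Y : PMatch n → Matrix (Fin r) (Fin r) ℝ}
    (hXY : Literature.Combinatorics.Optimization.IsPsdRect X Y) :
    Literature.Combinatorics.Optimization.IsPsdRect
      (fun Ut => X (liftOdd (verts S) (verts S) h Subset.rfl (even_card_verts_of_mem_anchoredCores hS) Ut))
      (fun Mt => Y (liftPMatch (verts S) S h (isPMOn_verts_of_mem_anchoredCores hS) Mt)) :=
  CutMatchingRestrictionStrategies.IsPsdRect.lift (isPMOn_verts_of_mem_anchoredCores hS) h Subset.rfl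
    (even_card_verts_of_mem_anchoredCores hS) (crossCount_verts_eq_zero hS) hXY

/-- **The value of the non-crossing sub-cell, read on the reduced strategy**: with `W = levelWeight n t C w`,
`Σ_{U ∈ A, U ∩ V = V} Σ_{M ∈ B, S ⊆ M} W(U,M)·tr(X_U Y_M) = Σ_{Ũ} Σ_{M̃} levelFn n t C w (|Ũ| + 2|S|) (cc Ũ M̃) · tr(X̃_Ũ Ỹ_M̃)` — the reduced
strategy against the level function shifted in the cut size only (`y = 0`). [cite: Rothvoss2017, §2 (PDF p. 6, eq. (2))] -/
theorem anchored_cell_value_eq_lift {r : ℕ} {R : Finset (Fin n)} {S : Finset (Sym2 (Fin n))} (hS : S ∈ anchoredCores R)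
    (h : (univ \ verts S).card = m) (t : ℕ) (C : Finset ℕ) (w : ℕ → ℝ)
    (X : OddSet n → Matrix (Fin r) (Fin r) ℝ) (Y : PMatch n → Matrix (Fin r) (Fin r) ℝ) (A : Finset (OddSet n)) (B : Finset (PMatch n)) :
    ∑ U ∈ A.filter (fun U => U.1 ∩ verts S = verts S), ∑ M ∈ B.filter (fun M => S ⊆ M.1),
        Literature.Combinatorics.Optimization.levelWeight n t C w U M * (X U * Y M).trace =
      ∑ Ut ∈ oddCellCuts A (verts S) (verts S) h, ∑ Mt ∈ pmCellMatchings B (verts S) S h,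
        levelFn n t C w (Ut.1.card + 2 * S.card) (cc Ut Mt) *
          (X (liftOdd (verts S) (verts S) h Subset.rfl (even_card_verts_of_mem_anchoredCores hS) Ut) *
            Y (liftPMatch (verts S) S h (isPMOn_verts_of_mem_anchoredCores hS) Mt)).trace := by
  rw [cell_value_eq_lift (isPMOn_verts_of_mem_anchoredCores hS) h Subset.rfl (even_card_verts_of_mem_anchoredCores hS)]
  refine sum_congr rfl fun Ut _ => sum_congr rfl fun Mt _ => ?_
  rw [crossCount_verts_eq_zero hS, add_zero, card_verts_of_mem_anchoredCores hS]

/-- **Crossing pins in the remainder**: a pair `(U, M)` of the crossing remainder of the star of `S ∈ 𝒮(R)` with `R ⊆ U` has an edge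
`e ∈ S ⊆ M` with exactly one endpoint in `U` (so in the cell's programme the tracial crossing-pin lemma applies at every dimension).
[cite: Rothvoss2017, §2 (PDF pp. 5–6)] -/
theorem exists_crossing_pin {R : Finset (Fin n)} {S : Finset (Sym2 (Fin n))} (hS : S ∈ anchoredCores R) {U : OddSet n}
    {M : PMatch n} (hRU : R ⊆ U.1) (hVU : ¬verts S ⊆ U.1) (hSM : S ⊆ M.1) : ∃ e ∈ M.1, e ∈ S ∧ Crosses U.1 e := by
  obtain ⟨e, heS, hc⟩ := exists_crossing_of_not_subset (isPMOn_verts_of_mem_anchoredCores hS) (meets_of_mem_anchoredCores hS) hRU hVU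
  exact ⟨e, hSM heS, heS, hc⟩

/-- The cut side of the non-crossing sub-cell is a SUB-STAR: `{U ∈ A : U ∩ verts S = verts S} = {U ∈ A : verts S ⊆ U}`, so its trace
weight's homogeneity is governed by §5 (`isRelHomogeneousW_cellCuts_of_dense`) and transported by §4 (`isRelHomogeneousW_oddCellCuts`).
[cite: KupavskiiZakharov2022, §2 (p. 6)] -/
theorem filter_inter_verts_eq (A : Finset (OddSet n)) (S : Finset (Sym2 (Fin n))) :
    A.filter (fun U => U.1 ∩ verts S = verts S) = A.filter (fun U => verts S ⊆ U.1) :=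
  filter_congr fun _ _ => inter_eq_right

end KernelPackaged

/-! ## §7 (appended) The cut side of a Kupavskii–Zakharov piece, reduced: the `OddSet` twin of `isRelHomogeneousW_pmCellMatchings_piece` -/

section DenseStar

variable {α : Type*} [DecidableEq α]

/-- **A dense sub-star of a piece that is homogeneous relative to a star.** If `x ≥ 0` carried by `𝒢 ⊆ 𝒜(R)` is `(𝒜(R), τ)`-homogeneous
(`τ ≥ 1`), `R ⊆ W`, and the sub-star `𝒢(W)` carries at least `K⁻¹ τ^{|W ∖ R|}` of its share (`K ≥ 1`), then `x` carried by `𝒢(W)` is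
`(𝒜(W), Kτ)`-homogeneous (`IsRelHomogeneousW.supersets_of_dense` read through `𝒜(R)(W ∖ R) = 𝒜(W)`).
[cite: KupavskiiZakharov2022, §2 and Observation 8] -/
theorem isRelHomogeneousW_supersets_of_dense_star {τ K : ℝ} (hτ : 1 ≤ τ) (hK : 1 ≤ K) {𝒜 𝒢 : Finset (Finset α)}
    {R W : Finset α} (hRW : R ⊆ W) (h𝒢 : 𝒢 ⊆ supersets 𝒜 R) {x : Finset α → ℝ} (hx : ∀ U, 0 ≤ x U)
    (hhom : IsRelHomogeneousW τ (supersets 𝒜 R) x 𝒢)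
    (hdense : τ ^ (W \ R).card * (supersets 𝒜 W).card * wmass x 𝒢 ≤ K * (wmass x (supersets 𝒢 W) * (supersets 𝒜 R).card)) :
    IsRelHomogeneousW (K * τ) (supersets 𝒜 W) x (supersets 𝒢 W) := by
  have hRW' : R ∪ (W \ R) = W := union_sdiff_of_subset hRW
  have h1 : supersets 𝒢 W = supersets 𝒢 (W \ R) := by
    ext U
    simp only [mem_supersets, and_congr_right_iff]
    intro hU
    have hRU : R ⊆ U := (mem_supersets.1 (h𝒢 hU)).2
    constructor
    · exact fun hWU => sdiff_subset.trans hWU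
    · intro hWRU a ha
      by_cases haR : a ∈ R
      · exact hRU haR
      · exact hWRU (mem_sdiff.2 ⟨ha, haR⟩)
  have h2 : supersets 𝒜 W = supersets (supersets 𝒜 R) (W \ R) := by rw [supersets_supersets, hRW']
  rw [h1, h2] at hdense ⊢
  exact hhom.supersets_of_dense hτ hK hx hdense

end DenseStar

section KernelPiece

variable {n m : ℕ}

/-- Selecting the odd cuts of `X` whose vertex sets lie in a subfamily `P ⊆ X` (e.g. a Kupavskii–Zakharov piece of the vertex-set family
of `X`) and forgetting the subtype gives back `P`. `PMatch` twin: `CutMatchingRestriction.image_val_filter_mem_eq`.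
[cite: KupavskiiZakharov2022, Lemma 11 (the pieces ℱ_i ⊆ ℱ)] -/
theorem image_val_filter_mem_eq_odd (X : Finset (OddSet n)) {P : Finset (Finset (Fin n))} (hP : P ⊆ X.image Subtype.val) :
    (X.filter fun U => U.1 ∈ P).image Subtype.val = P := by
  ext U
  simp only [mem_image, mem_filter]
  constructor
  · rintro ⟨U', ⟨-, hU'⟩, rfl⟩
    exact hU'
  · intro hU
    obtain ⟨U', hU'X, rfl⟩ := mem_image.1 (hP hU)
    exact ⟨U', ⟨hU'X, hU⟩, rfl⟩

/-- Forgetting the subtype commutes with the sub-star filter: the vertex sets of `{U ∈ X : W ⊆ U}` form `X(W)`.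
[cite: KupavskiiZakharov2022, §2 (p. 6: stars)] -/
theorem image_val_filter_subset_odd (X : Finset (OddSet n)) (W : Finset (Fin n)) :
    (X.filter fun U => W ⊆ U.1).image Subtype.val = supersets (X.image Subtype.val) W := by
  rw [supersets, filter_image]

/-- **THE CUT SIDE OF A PIECE ON A NON-CROSSING SUB-CELL, REDUCED** — the `OddSet` twin of
`CutMatchingRestrictionStrategies.isRelHomogeneousW_pmCellMatchings_piece`, with the density dichotomy of §5 built in. Let `X` be a
family of odd `t`-cuts with a weight `xO : OddSet n → ℝ`, `0 ≤ xO` (e.g. the trace density `U ↦ tr(X_U)/r`), zero-extended to all vertex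
sets; `D` a weighted Kupavskii–Zakharov approximation of the vertex-set family of `X` (ambient: all `t`-subsets; `τ ≥ 1`); `i` a piece with
vertex core `R = D.core i`; `S ∈ 𝒮(R)` an anchored core with support `W = verts S`, `|W| ≤ t`, `|univ ∖ W| = m`; and suppose the sub-star of
`W` in the piece carries at least `K⁻¹ τ^{|W ∖ R|}` of its share (`K ≥ 1`). Then the reduced weight of the non-crossing sub-cell — the zero
extension of `xO ∘ liftOdd` — carried by the vertex sets of `oddCellCuts {U ∈ X : U ∈ 𝒢_i, W ⊆ U} W W h` is `(Kτ)`-homogeneous relative to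
all `(t − |W|)`-cuts of `K_m`, and its mass is the `xO`-mass of that sub-cell's cut side.
[cite: KupavskiiZakharov2022, Lemma 11 (ii) and Observation 8] -/
theorem isRelHomogeneousW_oddCellCuts_piece_of_dense {τ K : ℝ} (hτ : 1 ≤ τ) (hK : 1 ≤ K) {t q : ℕ}
    (X : Finset (OddSet n)) (hX : X.image Subtype.val ⊆ univ.powersetCard t) (xO : OddSet n → ℝ) (hxO : ∀ U, 0 ≤ xO U)
    (D : WeightedSpreadApproximation (univ.powersetCard t) (X.image Subtype.val)
      (fun U : Finset (Fin n) => if hU : Odd U.card then xO ⟨U, hU⟩ else 0) τ q)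
    (i : Fin D.k) {S : Finset (Sym2 (Fin n))} (hS : S ∈ anchoredCores (D.core i)) (hWt : (verts S).card ≤ t)
    (h : (univ \ verts S).card = m)
    (hdense : τ ^ (verts S \ D.core i).card * (supersets (univ.powersetCard t : Finset (Finset (Fin n))) (verts S)).card *
        wmass (fun U : Finset (Fin n) => if hU : Odd U.card then xO ⟨U, hU⟩ else 0) (D.piece i) ≤
      K * (wmass (fun U : Finset (Fin n) => if hU : Odd U.card then xO ⟨U, hU⟩ else 0) (supersets (D.piece i) (verts S)) *
        (supersets (univ.powersetCard t : Finset (Finset (Fin n))) (D.core i)).card)) :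
    IsRelHomogeneousW (K * τ) (univ.powersetCard (t - (verts S).card))
        (fun Ut : Finset (Fin m) => if hU : Odd Ut.card then
          xO (liftOdd (verts S) (verts S) h Subset.rfl (even_card_verts_of_mem_anchoredCores hS) ⟨Ut, hU⟩) else 0)
        ((oddCellCuts ((X.filter fun U => U.1 ∈ D.piece i).filter fun U => verts S ⊆ U.1) (verts S) (verts S) h).image
          Subtype.val) ∧
      wmass (fun Ut : Finset (Fin m) => if hU : Odd Ut.card then
          xO (liftOdd (verts S) (verts S) h Subset.rfl (even_card_verts_of_mem_anchoredCores hS) ⟨Ut, hU⟩) else 0)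
        ((oddCellCuts ((X.filter fun U => U.1 ∈ D.piece i).filter fun U => verts S ⊆ U.1) (verts S) (verts S) h).image
          Subtype.val) =
        ∑ U ∈ (X.filter fun U => U.1 ∈ D.piece i).filter (fun U => verts S ⊆ U.1), xO U := by
  have hxF : ∀ U : Finset (Fin n), 0 ≤ (fun U : Finset (Fin n) => if hU : Odd U.card then xO ⟨U, hU⟩ else 0) U := fun U => by
    simp only
    split_ifs
    · exact hxO _
    · exact le_rfl
  have hRW : D.core i ⊆ verts S := subset_verts_of_mem_anchoredCores hS
  have hPsub : D.piece i ⊆ supersets (univ.powersetCard t) (D.core i) := D.piece_subset_supersets hX i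
  -- the sub-star of the piece is `(Kτ)`-homogeneous relative to the star of `W = verts S`
  have key0 := isRelHomogeneousW_supersets_of_dense_star hτ hK hRW hPsub hxF (D.homogeneous i) hdense
  -- the vertex sets of the sub-cell's cut family are that sub-star
  have himg : ((X.filter fun U => U.1 ∈ D.piece i).filter fun U => verts S ⊆ U.1).image Subtype.val =
      supersets (D.piece i) (verts S) := by
    rw [image_val_filter_subset_odd, image_val_filter_mem_eq_odd X (D.piece_subset_family i)]
  have hXiW : ((X.filter fun U => U.1 ∈ D.piece i).filter fun U => verts S ⊆ U.1).image Subtype.val ⊆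
      cutsWith (univ.powersetCard t) (verts S) (verts S) := by
    rw [himg, ← supersets_eq_cutsWith]
    exact supersets_mono (hPsub.trans (supersets_subset _ _)) (verts S)
  have hhom' : IsRelHomogeneousW (K * τ) (cutsWith (univ.powersetCard t) (verts S) (verts S))
      (fun U : Finset (Fin n) => if hU : Odd U.card then xO ⟨U, hU⟩ else 0)
      (((X.filter fun U => U.1 ∈ D.piece i).filter fun U => verts S ⊆ U.1).image Subtype.val) := by
    rw [himg, ← supersets_eq_cutsWith]
    exact key0
  obtain ⟨hh, hw⟩ := isRelHomogeneousW_oddCellCuts (V := verts S) (π := verts S) Subset.rfl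
    (even_card_verts_of_mem_anchoredCores hS) h hWt _ hXiW xO hhom'
  refine ⟨hh, hw.trans (sum_congr ?_ fun _ _ => rfl)⟩
  exact filter_true_of_mem fun U hU => inter_eq_right.2 (mem_filter.1 hU).2

end KernelPiece

end Literature.Combinatorics.AssociationSchemes.CutMatchingRestrictionCutCores
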